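import Literature.NumberTheory.Automorphic.LanglandsShelstad1987.Defs
import Literature.NumberTheory.Automorphic.LanglandsShelstad1987.KeyLemmasI
import Mathlib.GroupTheory.QuotientGroup.Defs
import Mathlib.Algebra.BigOperators.Finprod
import Mathlib.Analysis.Complex.Basic
import HarnessLib

/-!
# Langlands–Shelstad (1987), §2 «Key Lemmas», second half: (2.4) an explicit splitting, (2.5) χ-data,
# (2.6) a second application — the numbered statements as named facts over the shared carriers of `Defs`

R. P. Langlands, D. Shelstad, *On the definition of transfer factors*, Math. Ann. **278** (1987) 219–271
[LanglandsShelstad1987]; text = the authors' reissue held as `paper:doi-10-1007-bf01458070` (58 pp., own pagination;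
every pin «(reissue p. N)» is a page of THAT file).  This file covers reissue pp. 18–22: (2.4) the cochain `s_{p/q}`,
Lemma 2.4.A, Corollary 2.4.B; (2.5) χ-data, the cochain `r_p` of the Weil group, Lemma 2.5.A, the independence of
choices, Corollary 2.5.B (the cocycle `c`).  (2.6) (admissible embeddings `ξ : ᴸT → ᴸG`, Lemma 2.6.A, remarks
(2.6.1)–(2.6.5)) is the sibling `AdmissibleEmbeddings.lean`, which imports this file.  Squad TN (HCML «GO 500», SPLIT-v1 6bf6eba45b565d8c row TN-t02); topic
`NumberTheory/Automorphic/LanglandsShelstad1987`, namespace `Literature.NumberTheory.Automorphic.LanglandsShelstad1987.KeyLemmasII`.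
STATEMENTS ONLY: every `def` has a body; no theorem, no `sorry`, no `axiom`, no `instance`, no `notation`.

## Carriers (all from ★ `LanglandsShelstad1987/Defs.lean`, conventions (C1)–(C6) there)
`Γ` a group acting on the lattice `X` (`[DistribMulAction Γ X]`; print's `Σ = Γ × {1, ε}`, `ε = −1`), `R : Finset X`
with `IsStable Γ X R`, `IsSymm R`; gauges `p : X → ℤˣ` with `IsGauge R p`; the coefficient module «`k^× ⊗ X`» =
`UnitsTensor X k = X ⊗[ℤ] Additive kˣ` written ADDITIVELY, on which `Γ` acts through `X` by Mathlib's instance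
`TensorProduct.leftDistribMulAction` (print: «with trivial action of `k^×`»); `unitPow a λ` = print's `a^λ`;
`tCochain Γ k R p` = print's `t_p`; `stabPlus Γ X λ = Γ_{+λ}`, `stabPM Γ X λ = Γ_{±λ}`.  Coboundary conventions are
Mathlib's inhomogeneous ones (`groupCohomology.IsCoboundary₁/₂`: `∂c(σ,τ) = σ·c(τ) − c(στ) + c(σ)`), as in `Defs`.

## (2.5): the Weil group is an ABSTRACT extension (design note — read before objecting)
Print (reissue p. 19): «We consider the case `k = ℂ` and `Γ = Gal(L/F)` … Let `W` be the Weil group of `L/F`. Then `W`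
acts on `ℂ^× ⊗ X` through `W → Γ`», and (p. 19 (i)): «`χ_λ` is a character on `C_{+λ}` [= `F_{+λ}^×` or the idèle class
group] … In either case we may regard `χ_λ` as a character on `W_+ = W_{+λ}`» (local ∕ global class field theory,
`W_{L/F_{+λ}}^{ab} ≅ C_{+λ}`).  Everything (2.5)–(2.6) DO with χ-data happens on the Weil-group side, and the printed
proofs (pp. 20–24) are formal in a surjection `W → Γ`.  Neither Weil groups of local∕global fields nor the reciprocity
isomorphism are in Mathlib or the tree, so this file (and `AdmissibleEmbeddings`) type (2.5)–(2.6) over an ARBITRARY group extension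
`π : W →* Γ` («Weil dress»): χ-data are families `χ : X → W → ℂˣ` of characters of the subgroups
`W_{+λ} = π⁻¹(Γ_{+λ})` (`IsChiDataW`), print's conditions (ii) and (iii) being transcribed through the reciprocity
dictionary — (ii) `χ_{σλ} = χ_λ ∘ σ⁻¹` ↦ conjugation by a lift of `σ`; (iii) «`χ_λ` extends the quadratic character of
`F_+/F_±`» ↦ `χ_λ(v²) = −1` for `v ∈ W_{±λ} ∖ W_{+λ}` (inclusion `C_± ⊂ C_+` = transfer `W_± → W_+^{ab}`, and
`Ver(v) = v²` for `v ∉ W_+`; this is literally what the proof of Lemma 2.5.A uses, reissue p. 22 l. 1: «since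
`χ_λ(v₁²) = −1` and `χ_λ(v₁ x v₁⁻¹) = χ_λ(x)⁻¹`»).  The FIELD dress of χ-data (characters of `F_{+λ}^×`, needed only by
`Δ_II` in §3.3) is typed in `TransferFactorDefinition.lean`; the dictionary between the two dresses is local class field
theory and is NOT typed (no claim is made about it here).  Print's formula `r_p(x) = ∏ χ_λ(Nm_{L/F_+} σ_i x)^{λ_i}`,
`x ∈ L^×` (p. 22), which needs `L^× ⊂ W_{L/F}`, is likewise not typed.


## Index (print item ↦ declaration)
| item (reissue page) | declaration(s) |
|---|---|
| (2.4) `s_{p/q}` (p. 18) | `sCochain` |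
| «Observe that `s_{p/p} = s_{−p/p} = s_{p/−p} = 1`» (p. 18) | `Remark_2_4_trivial` |
| Lemma 2.4.A (p. 18) | `Lemma_2_4_A` |
| Corollary 2.4.B (i), (ii) (p. 19) | `Corollary_2_4_B_i`, `Corollary_2_4_B_ii` |
| (2.5) `Γ_{+λ}`, `Γ_{±λ}` (p. 19) | ★ `stabPlus`, ★ `stabPM` (`Defs`); `plusW`, `pmW` |
| (2.5) χ-data (i)–(iii) (pp. 19–20) | `IsChiDataW` (Weil dress, see above) |
| (2.5) `p`, `w_i`, `u_i(w)`, `v_0(u)`, `s(u)`, `r_p`, `r_q` (p. 20) | `gaugeOfSection`, `uFun`, `v0Fun`, `sFun`, `rCochain`, `rqCochain` |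
| Lemma 2.5.A (p. 20) | `Lemma_2_5_A` |
| «the various choices made have no effect on `r_q`, up to 1-coboundaries» (p. 22) | `Remark_2_5_indep` |
| Corollary 2.5.B (p. 22) | `IsZetaDataW`, `cCochain`, `Corollary_2_5_B_cocycle`, `Corollary_2_5_B_indep` |
| (2.5) non-transitive `R`: «take products over all such pairs» (p. 22) | `rCochainTotal`, `cCochainTotal` |
| (2.6), Lemma 2.6.A, (2.6.1)–(2.6.5) (pp. 22–25) | sibling file `AdmissibleEmbeddings.lean` |
-/

noncomputable section

open scoped TensorProduct Pointwise

namespace Literature.NumberTheory.Automorphic.LanglandsShelstad1987.KeyLemmasII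

universe u v w u₁

/-! ## (2.4) An explicit splitting (reissue pp. 18–19) -/

section ExplicitSplitting

variable {Γ : Type u} [Group Γ] {X : Type v} [AddCommGroup X] [DistribMulAction Γ X]
variable (k : Type w) [Field k]

/-- **`s_{p/q}(σ) = ∏^{(p)}_{(−q)} (−1)^λ · ∏^{(−q)}_{(p)} (−1)^λ`, `σ ∈ Γ`** (reissue p. 18): the first product over
`λ ∈ R` with `p(λ) = 1`, `p(σ⁻¹λ) = −1`, `q(λ) = q(σ⁻¹λ) = 1`, the second over `λ ∈ R` with `p(λ) = p(σ⁻¹λ) = 1`,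
`q(λ) = −1`, `q(σ⁻¹λ) = 1`; a 1-cochain of `Γ` in `k^× ⊗ X` (additively: a sum of `unitPow (-1) λ`).
[cite: LanglandsShelstad1987, §2.4 (reissue p. 18)] -/
def sCochain (R : Finset X) (p q : X → ℤˣ) (σ : Γ) : UnitsTensor X k :=
  (∑ l ∈ R with (p l = 1 ∧ p (σ⁻¹ • l) = -1 ∧ q l = 1 ∧ q (σ⁻¹ • l) = 1), unitPow (-1 : kˣ) l) +
    ∑ l ∈ R with (p l = 1 ∧ p (σ⁻¹ • l) = 1 ∧ q l = -1 ∧ q (σ⁻¹ • l) = 1), unitPow (-1 : kˣ) l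

/-- «Observe that `s_{p/p} = s_{−p/p} = s_{p/−p} = 1`» (reissue p. 18), for gauges `p` on a `Γ`-stable `R = −R`
(additively: `= 0`). [cite: LanglandsShelstad1987, §2.4 (reissue p. 18)] -/
def Remark_2_4_trivial : Prop :=
  ∀ {Γ : Type u} [Group Γ] {X : Type v} [AddCommGroup X] [DistribMulAction Γ X] (k : Type w) [Field k]
    (R : Finset X) (p : X → ℤˣ), IsStable Γ X R → IsSymm R → IsGauge R p →
    ∀ σ : Γ, sCochain k R p p σ = 0 ∧ sCochain k R (-p) p σ = 0 ∧ sCochain k R p (-p) σ = 0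

/-- **Lemma 2.4.A** (reissue p. 18): «The coboundary of `s_{p/q}` is `t_p/t_q`.»  Setting of (2.1) (p. 11): `k` a field of
characteristic zero, `X` a free finitely generated `ℤ`-module with `Γ`-action, `R ⊂ X` finite, `Γ`-stable with `−R = R`,
`p`, `q` gauges on `R`; coboundary in Mathlib's inhomogeneous convention `∂s(σ,τ) = σ·s(τ) − s(στ) + s(σ)` (additive
form of print's `s(σ)σ(s(τ))s(στ)⁻¹`), `Γ` acting on `k^× ⊗ X` through `X`.  The printed proof (pp. 18–19) is a formal
case analysis valid in this generality. [cite: LanglandsShelstad1987, Lemma 2.4.A (reissue p. 18)] -/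
def Lemma_2_4_A : Prop :=
  ∀ {Γ : Type u} [Group Γ] {X : Type v} [AddCommGroup X] [DistribMulAction Γ X] [Module.Free ℤ X]
    [Module.Finite ℤ X] (k : Type w) [Field k] [CharZero k] (R : Finset X) (p q : X → ℤˣ),
    IsStable Γ X R → IsSymm R → IsGauge R p → IsGauge R q →
    ∀ σ τ : Γ, σ • sCochain k R p q τ - sCochain k R p q (σ * τ) + sCochain k R p q σ =
      tCochain Γ k R p (σ, τ) - tCochain Γ k R q (σ, τ)

/-- **Corollary 2.4.B (i)** (reissue p. 19): «`s_{q/p}` is cohomologous to `s_{p/q}`» — their difference (print's quotient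
`s_{q/p}s_{p/q}⁻¹`, additively; all values of `s` are 2-torsion) is a 1-coboundary of `Γ` in `k^× ⊗ X` (Mathlib's
`groupCohomology.IsCoboundary₁`).  Setting as in Lemma 2.4.A.
[cite: LanglandsShelstad1987, Corollary 2.4.B (reissue p. 19)] -/
def Corollary_2_4_B_i : Prop :=
  ∀ {Γ : Type u} [Group Γ] {X : Type v} [AddCommGroup X] [DistribMulAction Γ X] [Module.Free ℤ X]
    [Module.Finite ℤ X] (k : Type w) [Field k] [CharZero k] (R : Finset X) (p q : X → ℤˣ),
    IsStable Γ X R → IsSymm R → IsGauge R p → IsGauge R q →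
    groupCohomology.IsCoboundary₁ (fun σ : Γ => sCochain k R q p σ - sCochain k R p q σ)

/-- **Corollary 2.4.B (ii)** (reissue p. 19): «`s_{p/q} s_{q/r}` is cohomologous to `s_{p/r}`» (additively:
`s_{p/q} + s_{q/r} − s_{p/r}` is a 1-coboundary).  Setting as in Lemma 2.4.A. [cite: LanglandsShelstad1987, Corollary 2.4.B (reissue p. 19)] -/
def Corollary_2_4_B_ii : Prop :=
  ∀ {Γ : Type u} [Group Γ] {X : Type v} [AddCommGroup X] [DistribMulAction Γ X] [Module.Free ℤ X]
    [Module.Finite ℤ X] (k : Type w) [Field k] [CharZero k] (R : Finset X) (p q r : X → ℤˣ),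
    IsStable Γ X R → IsSymm R → IsGauge R p → IsGauge R q → IsGauge R r →
    groupCohomology.IsCoboundary₁
      (fun σ : Γ => sCochain k R p q σ + sCochain k R q r σ - sCochain k R p r σ)

end ExplicitSplitting

/-! ## (2.5) χ-data and the cochain `r_p` of the Weil group (reissue pp. 19–22), Weil dress -/

section ChiData

variable {Γ : Type u} [Group Γ] {X : Type v} [AddCommGroup X] [DistribMulAction Γ X]
variable {W : Type w} [Group W] (π : W →* Γ)

/-- `W_{+λ} = W_{L/F_{+λ}}` (reissue p. 19: «Set `W_± = W_{L/F_±}` and `W_+ = W_{L/F_+}`»): the preimage of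
`Γ_{+λ}` under `π : W → Γ`. [cite: LanglandsShelstad1987, §2.5 (reissue p. 19)] -/
def plusW (l : X) : Subgroup W := (stabPlus Γ X l).comap π

/-- `W_{±λ} = W_{L/F_{±λ}}` (reissue p. 19): the preimage of `Γ_{±λ}` under `π : W → Γ`.
[cite: LanglandsShelstad1987, §2.5 (reissue p. 19)] -/
def pmW (l : X) : Subgroup W := (stabPM Γ X l).comap π

/-- **χ-data for the action of `Γ` on `R`**, Weil dress (reissue pp. 19–20; see the module docstring for the
dictionary): «a collection `{χ_λ : λ ∈ R}` such that (i) `χ_λ` is a character on `C_{+λ}` … we may regard `χ_λ` as a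
character on `W_+ = W_{+λ}`; (ii) `χ_{−λ} = χ_λ⁻¹` and `χ_{σλ} = χ_λ ∘ σ⁻¹`, `σ ∈ Γ`, `λ ∈ R`; (iii) if `[F_+ : F_±] = 2`
then `χ_λ`, as character on `C_+`, extends the quadratic character on `C_±` attached to the extension `F_+/F_±`.»
Here `χ : X → W → ℂˣ` is a total function read only on `λ ∈ R`, `u ∈ W_{+λ}`: (i) multiplicative on `W_{+λ}`;
(ii) `χ_{−λ}(u) = χ_λ(u)⁻¹` on `W_{+λ}` (note `W_{+(−λ)} = W_{+λ}`) and `χ_{π(w)λ}(w u w⁻¹) = χ_λ(u)`; (iii) `χ_λ(v²) = −1`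
for `v ∈ W_{±λ} ∖ W_{+λ}` (vacuous when `Γ_{+λ} = Γ_{±λ}`, i.e. `[F_+ : F_±] = 1`).
[cite: LanglandsShelstad1987, §2.5 (reissue pp. 19–20)] -/
def IsChiDataW (R : Finset X) (χ : X → W → ℂˣ) : Prop :=
  ∀ l ∈ R,
    (∀ u ∈ plusW π l, ∀ u' ∈ plusW π l, χ l (u * u') = χ l u * χ l u') ∧
    (∀ u ∈ plusW π l, χ (-l) u = (χ l u)⁻¹) ∧
    (∀ w : W, ∀ u ∈ plusW π l, χ (π w • l) (w * u * w⁻¹) = χ l u) ∧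
    (∀ v ∈ pmW π l, v ∉ plusW π l → χ l (v * v) = -1)

variable (l : X)

/-- The elements `λ_i = σ_i⁻¹λ` (reissue p. 20): print chooses representatives `σ_1, …, σ_n` of `Γ_±\Γ` and lifts
`w_i ↦ σ_i` in `W`, «representatives for `W_±\W`».  Here the cosets are indexed by `W ⧸ W_{±λ}` (left cosets of
`y_i = w_i⁻¹`) and `y : W ⧸ W_{±λ} → W` is a section (hypothesis `∀ i, ↑(y i) = i` where used); `λ_i = π(y_i)·λ`.
[cite: LanglandsShelstad1987, §2.5 (reissue p. 20)] -/
def lamOf (y : W ⧸ pmW π l → W) (i : W ⧸ pmW π l) : X := π (y i) • l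

/-- The gauge `p` of (2.5) (reissue p. 20): «Define a gauge `p` on `R` by `p(λ′) = 1` if and only if `λ′ = σ_i⁻¹λ`,
some `1 ≤ i ≤ n`» (and `p(λ′) = −1` otherwise). [cite: LanglandsShelstad1987, §2.5 (reissue p. 20)] -/
def gaugeOfSection (y : W ⧸ pmW π l → W) : X → ℤˣ := fun m =>
  @ite _ (∃ i : W ⧸ pmW π l, m = lamOf π l y i) (Classical.dec _) 1 (-1)

/-- `u_i(w) ∈ W_±` (reissue p. 20: «If `w ∈ W` then define `u_i(w) ∈ W_±` by `w_i w = u_i(w) w_j`», `j` the index of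
the coset `W_± w_i w`): with `w_i = y_i⁻¹` this is `u_i(w) = y_i⁻¹ w y_j`, `j = (w⁻¹ y_i) W_{±λ}`.
[cite: LanglandsShelstad1987, §2.5 (reissue p. 20)] -/
def uFun (y : W ⧸ pmW π l → W) (i : W ⧸ pmW π l) (w : W) : W :=
  (y i)⁻¹ * w * y (↑(w⁻¹ * y i))

/-- `v_0(u) ∈ W_+` for `u ∈ W_±` (reissue p. 20: «Choose representatives `v_0 ∈ W_+` and `v_1` for `W_+\W_±` …
For `u ∈ W_±` define `v_0(u) ∈ W_+` by `v_0 · u = v_0(u) · v_i`, where `i = 0` or `1`, as appropriate»), i.e.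
`v_0(u) = v_0 u v_0⁻¹` if `u ∈ W_+` and `v_0 u v_1⁻¹` otherwise. [cite: LanglandsShelstad1987, §2.5 (reissue p. 20)] -/
def v0Fun (v₀ v₁ : W) (u : W) : W :=
  @ite _ (u ∈ plusW π l) (Classical.dec _) (v₀ * u * v₀⁻¹) (v₀ * u * v₁⁻¹)

/-- `s(u) = χ_λ(v_0(u))` for `u ∈ W_±` (reissue p. 20). [cite: LanglandsShelstad1987, §2.5 (reissue p. 20)] -/
def sFun (χ : X → W → ℂˣ) (v₀ v₁ : W) (u : W) : ℂˣ := χ l (v0Fun π l v₀ v₁ u)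

/-- **`r_p(w) = ∏_{i=1}^n χ_λ(v_0(u_i(w)))^{λ_i} = ∏_i s(u_i(w))^{λ_i}`** (reissue p. 20), «a 1-chain of `W` with values
in `ℂ^× ⊗ X`», for ONE `Σ`-orbit `R = ±Γλ` (transitive case); additively a `finsum` over `W ⧸ W_{±λ}` (finite whenever
`Γ_{±λ}` has finite index, e.g. `Γ` finite; the junk value `0` otherwise is never read by the statements below).
[cite: LanglandsShelstad1987, §2.5 (reissue p. 20)] -/
def rCochain (χ : X → W → ℂˣ) (y : W ⧸ pmW π l → W) (v₀ v₁ : W) (w : W) : UnitsTensor X ℂ :=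
  ∑ᶠ i : W ⧸ pmW π l, unitPow (sFun π l χ v₀ v₁ (uFun π l y i w)) (lamOf π l y i)

/-- **`r_q = s_{q/p} r_p`** for any gauge `q` on `R` (reissue p. 20), `p` the gauge of the construction
(`gaugeOfSection`); additively `r_q(w) = s_{q/p}(π w) + r_p(w)`. [cite: LanglandsShelstad1987, §2.5 (reissue p. 20)] -/
def rqCochain (R : Finset X) (q : X → ℤˣ) (χ : X → W → ℂˣ) (y : W ⧸ pmW π l → W) (v₀ v₁ : W) (w : W) :
    UnitsTensor X ℂ :=
  sCochain ℂ R q (gaugeOfSection π l y) (π w) + rCochain π l χ y v₀ v₁ w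

variable (Γ) in
/-- The transitive setting of (2.5) (reissue p. 20: «we shall at first assume that `Σ` acts transitively on `R`»):
`R = ±Γλ` is ONE `Σ`-orbit, `λ ∈ R`. [cite: LanglandsShelstad1987, §2.5 (reissue p. 20)] -/
def IsSigmaOrbitOf (R : Finset X) (l : X) : Prop :=
  l ∈ R ∧ ∀ m : X, m ∈ R ↔ (∃ σ : Γ, m = σ • l) ∨ ∃ σ : Γ, m = -(σ • l)

variable (Γ) in
/-- Admissible choices for the construction of `r_p` (reissue p. 20): `y` a section of `W → W ⧸ W_{±λ}` (the lifts
`w_i⁻¹`), `v_0 ∈ W_+`, and `v_1 ∈ W_± ∖ W_+` when `[F_+ : F_±] = 2` (print: «a representative `v_1` for `W_+\W_±` in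
case `[F_+ : F_±] = 2` and an element `v_0` of `W_+` if `F_+ = F_±`»; `v_1` is then unused).
[cite: LanglandsShelstad1987, §2.5 (reissue p. 20)] -/
def IsChoice (y : W ⧸ pmW π l → W) (v₀ v₁ : W) : Prop :=
  (∀ i : W ⧸ pmW π l, (y i : W ⧸ pmW π l) = i) ∧ v₀ ∈ plusW π l ∧
    (stabPlus Γ X l ≠ stabPM Γ X l → v₁ ∈ pmW π l ∧ v₁ ∉ plusW π l)

/-- **Lemma 2.5.A** (reissue p. 20): «The coboundary of `r_q` is `t_q`.»  Setting (p. 19): `k = ℂ`, `X` a free finitely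
generated `ℤ`-module with `Γ`-action, `R = ±Γλ ⊂ X` one finite `Σ`-orbit (transitive case; the general case is the
product over orbits, `rCochainTotal`), `Γ` finite (print: `Γ = Gal(L/F)`), `π : W → Γ` surjective (print: the Weil
group `W_{L/F} → Γ`), `{χ_λ}` χ-data (Weil dress), admissible choices (`IsChoice`), the `p` of the construction a gauge
on `R` (print: «Define a gauge `p` on `R` by …»; this holds as soon as `λ ≠ 0` in the lattice `X`) and `q` any gauge on
`R`; `W` acting on `ℂ^× ⊗ X` through `π` and `X`; inhomogeneous coboundary `∂r(v,w) = v·r(w) − r(vw) + r(v)` and `t_q`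
inflated to `W`.  The printed proof (pp. 20–22) is formal in the surjection `W → Γ`. [cite: LanglandsShelstad1987, Lemma 2.5.A (reissue p. 20)] -/
def Lemma_2_5_A : Prop :=
  ∀ {Γ : Type u} [Group Γ] [Finite Γ] {X : Type v} [AddCommGroup X] [DistribMulAction Γ X] [Module.Free ℤ X]
    [Module.Finite ℤ X] {W : Type w} [Group W] (π : W →* Γ), Function.Surjective π →
    ∀ (R : Finset X) (l : X) (χ : X → W → ℂˣ) (y : W ⧸ pmW π l → W) (v₀ v₁ : W) (q : X → ℤˣ),
    IsStable Γ X R → IsSymm R → IsSigmaOrbitOf Γ R l → IsChiDataW π R χ → IsChoice Γ π l y v₀ v₁ →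
    IsGauge R (gaugeOfSection π l y) → IsGauge R q →
    ∀ v w : W, π v • rqCochain π l R q χ y v₀ v₁ w - rqCochain π l R q χ y v₀ v₁ (v * w) +
      rqCochain π l R q χ y v₀ v₁ v = tCochain Γ ℂ R q (π v, π w)

/-- **Independence of the choices** (reissue p. 22: «It remains to check that the various choices made have no effect on
`r_q`, up to 1-coboundaries» — the choices being `v_0`, `v_1`, `w_1, …, w_n` and `λ`, for `q` fixed): for two admissible
choice tuples on the same `Σ`-orbit `R`, `r_q − r_q′` is a 1-coboundary of `W` (`= w·m − m` for some `m ∈ ℂ^× ⊗ X`).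
Setting as in Lemma 2.5.A. [cite: LanglandsShelstad1987, §2.5 (reissue p. 22)] -/
def Remark_2_5_indep : Prop :=
  ∀ {Γ : Type u} [Group Γ] [Finite Γ] {X : Type v} [AddCommGroup X] [DistribMulAction Γ X] [Module.Free ℤ X]
    [Module.Finite ℤ X] {W : Type w} [Group W] (π : W →* Γ), Function.Surjective π →
    ∀ (R : Finset X) (l l' : X) (χ : X → W → ℂˣ) (y : W ⧸ pmW π l → W) (y' : W ⧸ pmW π l' → W)
    (v₀ v₁ v₀' v₁' : W) (q : X → ℤˣ),
    IsStable Γ X R → IsSymm R → IsSigmaOrbitOf Γ R l → IsSigmaOrbitOf Γ R l' → IsChiDataW π R χ →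
    IsChoice Γ π l y v₀ v₁ → IsChoice Γ π l' y' v₀' v₁' →
    IsGauge R (gaugeOfSection π l y) → IsGauge R (gaugeOfSection π l' y') → IsGauge R q →
    ∃ m : UnitsTensor X ℂ, ∀ w : W,
      rqCochain π l R q χ y v₀ v₁ w - rqCochain π l' R q χ y' v₀' v₁' w = π w • m - m

/-- The datum of **Corollary 2.5.B** (reissue p. 22), Weil dress: «`{ζ_λ : λ ∈ R}` satisfies: (i) `ζ_λ` is a character
on `C_{+λ}` and hence on `W_{+λ}`. (ii) `ζ_{σλ} = ζ_λ ∘ σ⁻¹`, `σ ∈ Γ`, `λ ∈ R` and `ζ_{−λ} = ζ_λ⁻¹`, `λ ∈ R`. (iii) If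
`[F_{+λ} : F_{±λ}] = 2` then `ζ_λ` is trivial on `C_{±λ}`» — (iii) transcribed as `ζ_λ(v²) = 1` for
`v ∈ W_{±λ} ∖ W_{+λ}` (transfer `W_± → W_+^{ab}`, as for `IsChiDataW`). [cite: LanglandsShelstad1987, Corollary 2.5.B (reissue p. 22)] -/
def IsZetaDataW (R : Finset X) (ζ : X → W → ℂˣ) : Prop :=
  ∀ l ∈ R,
    (∀ u ∈ plusW π l, ∀ u' ∈ plusW π l, ζ l (u * u') = ζ l u * ζ l u') ∧
    (∀ u ∈ plusW π l, ζ (-l) u = (ζ l u)⁻¹) ∧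
    (∀ w : W, ∀ u ∈ plusW π l, ζ (π w • l) (w * u * w⁻¹) = ζ l u) ∧
    (∀ v ∈ pmW π l, v ∉ plusW π l → ζ l (v * v) = 1)

/-- **`c(w) = ∏_{i=1}^n ζ_λ(v_0(u_i(w)))^{λ_i}`, `w ∈ W`** (Corollary 2.5.B, reissue p. 22) — the same formula as `r_p` with
`ζ` for `χ`, for one `Σ`-orbit. [cite: LanglandsShelstad1987, Corollary 2.5.B (reissue p. 22)] -/
def cCochain (ζ : X → W → ℂˣ) (y : W ⧸ pmW π l → W) (v₀ v₁ : W) (w : W) : UnitsTensor X ℂ :=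
  rCochain π l ζ y v₀ v₁ w

/-- **Corollary 2.5.B, first assertion** (reissue p. 22): for `{ζ_λ}` as in `IsZetaDataW`, `c` «is a 1-cocycle of `W`
with values in `ℂ^× ⊗ X`»: `c(vw) = v·c(w) + c(v)` (additively, `W` acting through `π` and `X`).  Setting as in
Lemma 2.5.A. [cite: LanglandsShelstad1987, Corollary 2.5.B (reissue p. 22)] -/
def Corollary_2_5_B_cocycle : Prop :=
  ∀ {Γ : Type u} [Group Γ] [Finite Γ] {X : Type v} [AddCommGroup X] [DistribMulAction Γ X] [Module.Free ℤ X]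
    [Module.Finite ℤ X] {W : Type w} [Group W] (π : W →* Γ), Function.Surjective π →
    ∀ (R : Finset X) (l : X) (ζ : X → W → ℂˣ) (y : W ⧸ pmW π l → W) (v₀ v₁ : W),
    IsStable Γ X R → IsSymm R → IsSigmaOrbitOf Γ R l → IsZetaDataW π R ζ → IsChoice Γ π l y v₀ v₁ →
    IsGauge R (gaugeOfSection π l y) →
    ∀ v w : W, cCochain π l ζ y v₀ v₁ (v * w) = π v • cCochain π l ζ y v₀ v₁ w + cCochain π l ζ y v₀ v₁ v

/-- **Corollary 2.5.B, second assertion** (reissue p. 22): «Its cohomology class is independent of the choices made in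
its construction»: for two admissible choice tuples, `c − c′` is a 1-coboundary of `W`.  Setting as in Lemma 2.5.A.
[cite: LanglandsShelstad1987, Corollary 2.5.B (reissue p. 22)] -/
def Corollary_2_5_B_indep : Prop :=
  ∀ {Γ : Type u} [Group Γ] [Finite Γ] {X : Type v} [AddCommGroup X] [DistribMulAction Γ X] [Module.Free ℤ X]
    [Module.Finite ℤ X] {W : Type w} [Group W] (π : W →* Γ), Function.Surjective π →
    ∀ (R : Finset X) (l l' : X) (ζ : X → W → ℂˣ) (y : W ⧸ pmW π l → W) (y' : W ⧸ pmW π l' → W)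
    (v₀ v₁ v₀' v₁' : W),
    IsStable Γ X R → IsSymm R → IsSigmaOrbitOf Γ R l → IsSigmaOrbitOf Γ R l' → IsZetaDataW π R ζ →
    IsChoice Γ π l y v₀ v₁ → IsChoice Γ π l' y' v₀' v₁' →
    IsGauge R (gaugeOfSection π l y) → IsGauge R (gaugeOfSection π l' y') →
    ∃ m : UnitsTensor X ℂ, ∀ w : W,
      cCochain π l ζ y v₀ v₁ w - cCochain π l' ζ y' v₀' v₁' w = π w • m - m

/-! ### (2.5), general `R`: products over the pairs `±𝒪` of `Γ`-orbits (reissue p. 22) -/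

variable {l}

variable (Γ) in
/-- A set `Λ ⊆ R` of representatives of the `Σ`-orbits `±𝒪` in `R` (reissue p. 22: «If the action of `Σ` on `R` is not
transitive we define `r_q` and `c` for each `Σ`-orbit, thus for each pair `±𝒪` of `Γ`-orbits»): every `μ ∈ R` lies in
`±Γλ` for exactly one `λ ∈ Λ`. [cite: LanglandsShelstad1987, §2.5 (reissue p. 22)] -/
def IsPairOrbitRepSet (R Λ : Finset X) : Prop :=
  Λ ⊆ R ∧ ∀ μ ∈ R, ∃! l, l ∈ Λ ∧ ((∃ σ : Γ, μ = σ • l) ∨ ∃ σ : Γ, μ = -(σ • l))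

variable (Γ) in
/-- The `Σ`-orbit `±Γλ ∩ R` of `λ` inside `R`, as a `Finset` (reissue p. 22). [cite: LanglandsShelstad1987, §2.5
(reissue p. 22)] -/
def sigmaOrbitIn (R : Finset X) (l : X) : Finset X :=
  @Finset.filter X (fun μ => (∃ σ : Γ, μ = σ • l) ∨ ∃ σ : Γ, μ = -(σ • l)) (Classical.decPred _) R

/-- **`r_q` for general `R`** (reissue p. 22: «and then take products over all such pairs. The results are denoted again
`r_q` and `c`»): the sum over `λ ∈ Λ` of the one-orbit cochains `r_q^{(λ)}` (each with its own choices `y_λ, v_{0,λ},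
v_{1,λ}` and the restriction of `q` to `±Γλ`). [cite: LanglandsShelstad1987, §2.5 (reissue p. 22)] -/
def rCochainTotal (R Λ : Finset X) (q : X → ℤˣ) (χ : X → W → ℂˣ) (y : (l : X) → W ⧸ pmW π l → W)
    (v₀ v₁ : X → W) (w : W) : UnitsTensor X ℂ :=
  ∑ l ∈ Λ, rqCochain π l (sigmaOrbitIn Γ R l) q χ (y l) (v₀ l) (v₁ l) w

/-- **`c` for general `R`** (Corollary 2.5.B with reissue p. 22, last paragraph): the sum over `λ ∈ Λ` of the one-orbit
cocycles `c^{(λ)}`. [cite: LanglandsShelstad1987, Corollary 2.5.B (reissue p. 22)] -/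
def cCochainTotal (Λ : Finset X) (ζ : X → W → ℂˣ) (y : (l : X) → W ⧸ pmW π l → W) (v₀ v₁ : X → W) (w : W) :
    UnitsTensor X ℂ :=
  ∑ l ∈ Λ, cCochain π l ζ (y l) (v₀ l) (v₁ l) w

end ChiData

/-! ## Discharges (proof lane; statements above untouched) -/

section Discharges

/-- Discharge of `Remark_2_4_trivial` («`s_{p/p} = s_{−p/p} = s_{p/−p} = 1`», reissue p. 18): each of the six defining
filters of `sCochain` is contradictory (`p(μ) = 1` and `p(μ) = −1` for the same `μ`), so every sum is empty.
[cite: LanglandsShelstad1987, §2.4 (reissue p. 18)] -/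
theorem Remark_2_4_trivial_holds : Remark_2_4_trivial := by
  intro Γ _ X _ _ k _ R p _ _ _ σ
  have h1 : (1 : ℤˣ) ≠ -1 := by decide
  refine ⟨?_, ?_, ?_⟩
  all_goals
    simp only [sCochain]
    rw [Finset.sum_eq_zero, Finset.sum_eq_zero, add_zero]
    all_goals
      intro l hl
      simp only [Finset.mem_filter, Pi.neg_apply, neg_eq_iff_eq_neg, neg_neg] at hl
      exfalso
      rcases hl with ⟨-, ha, hb, hc, hd⟩
      first
        | exact h1 (ha.symm.trans hc)
        | exact h1 (hc.symm.trans ha)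
        | exact h1 (hb.symm.trans hd)
        | exact h1 (hd.symm.trans hb)


/-- Discharge of `Lemma_2_4_A` [cite: LanglandsShelstad1987, Lemma 2.4.A (reissue p. 18)]: the coboundary of `s_{p/q}` is
`t_p/t_q` — by TN-t01's ★ `KeyLemmasI.cobd_splitCochain` (whose `splitCochain` has the same body as `sCochain`). -/
theorem Lemma_2_4_A_holds : Lemma_2_4_A := by
  intro Γ _ X _ _ _ _ k _ _ R p q hR hS hp hq σ τ
  exact KeyLemmasI.cobd_splitCochain k R p q hR hS hp hq σ τ

/-! ### The 1-cocycle `c` of Corollary 2.5.B (reissue pp. 20–22): auxiliary identities of the printed proof -/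

section CocycleAux

variable {Γ : Type*} [Group Γ] {X : Type*} [AddCommGroup X] [DistribMulAction Γ X]
variable {W : Type*} [Group W] (π : W →* Γ) (l : X)

/-- `w ∈ W_{+λ} ↔ π(w)λ = λ` (definition of `W_+`, reissue p. 19). [cite: LanglandsShelstad1987, §2.5 (reissue p. 19)] -/
theorem mem_plusW_iff (w : W) : w ∈ plusW π l ↔ π w • l = l := by
  simp [plusW, stabPlus, Subgroup.mem_comap, MulAction.mem_stabilizer_iff]

/-- `w ∈ W_{±λ} ↔ π(w)λ = ±λ` (definition of `W_±`, reissue p. 19: «`Γ_{±λ} = {σ : σλ = ±λ}`»). [cite: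
LanglandsShelstad1987, §2.5 (reissue p. 19)] -/
theorem mem_pmW_iff (w : W) : w ∈ pmW π l ↔ π w • l = l ∨ π w • l = -l := by
  simp only [pmW, stabPM, Subgroup.mem_comap, MulAction.mem_stabilizer_iff]
  constructor
  · intro h
    have hl : π w • l ∈ π w • ({l, -l} : Set X) := Set.smul_mem_smul_set (by simp)
    rw [h] at hl
    simpa using hl
  · intro h
    rcases h with h | h
    · rw [Set.smul_set_insert, Set.smul_set_singleton, smul_neg, h]
    · rw [Set.smul_set_insert, Set.smul_set_singleton, smul_neg, h, neg_neg, Set.pair_comm]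

/-- `W_{+λ} ≤ W_{±λ}` (reissue p. 19: `F ⊆ F_± ⊆ F_+`). [cite: LanglandsShelstad1987, §2.5 (reissue p. 19)] -/
theorem plusW_le_pmW : plusW π l ≤ pmW π l := fun w hw =>
  (mem_pmW_iff π l w).mpr (Or.inl ((mem_plusW_iff π l w).mp hw))

/-- An element of `W_{±λ} ∖ W_{+λ}` sends `λ` to `−λ` (reissue p. 19). [cite: LanglandsShelstad1987, §2.5 (reissue p.
19)] -/
theorem smul_eq_neg_of_mem_pmW {w : W} (hw : w ∈ pmW π l) (hw' : w ∉ plusW π l) : π w • l = -l := by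
  rw [mem_pmW_iff] at hw
  rw [mem_plusW_iff] at hw'
  exact hw.resolve_left hw'

/-- For `g ∈ W_±` and `u ∈ W_+`, `g u g⁻¹ ∈ W_+` (`[F_+ : F_±] ≤ 2`, reissue p. 19). [cite: LanglandsShelstad1987, §2.5
(reissue p. 19)] -/
theorem conj_mem_plusW {g u : W} (hg : g ∈ pmW π l) (hu : u ∈ plusW π l) :
    g * u * g⁻¹ ∈ plusW π l := by
  rw [mem_plusW_iff] at hu ⊢
  rw [mem_pmW_iff] at hg
  rw [map_mul, map_mul, mul_smul, mul_smul, map_inv]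
  rcases hg with h | h
  · have h' : (π g)⁻¹ • l = l := by rw [inv_smul_eq_iff, h]
    rw [h', hu, h]
  · have h' : (π g)⁻¹ • l = -l := by rw [inv_smul_eq_iff, smul_neg, h, neg_neg]
    rw [h', smul_neg, hu, smul_neg, h, neg_neg]

/-- The product of two elements of `W_± ∖ W_+` lies in `W_+` (`[F_+ : F_±] ≤ 2`, reissue p. 19). [cite:
LanglandsShelstad1987, §2.5 (reissue p. 19)] -/
theorem mul_mem_plusW_of_not_mem {a b : W} (ha : a ∈ pmW π l) (ha' : a ∉ plusW π l) (hb : b ∈ pmW π l)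
    (hb' : b ∉ plusW π l) : a * b ∈ plusW π l := by
  have h1 := smul_eq_neg_of_mem_pmW π l ha ha'
  have h2 := smul_eq_neg_of_mem_pmW π l hb hb'
  rw [mem_plusW_iff, map_mul, mul_smul, h2, smul_neg, h1, neg_neg]

/-- `W_+ · (W ∖ W_+) ⊆ W ∖ W_+` (reissue p. 19). [cite: LanglandsShelstad1987, §2.5 (reissue p. 19)] -/
theorem mul_not_mem_plusW_left {a b : W} (ha : a ∈ plusW π l) (hb' : b ∉ plusW π l) :
    a * b ∉ plusW π l := by
  intro h
  exact hb' ((Subgroup.mul_mem_cancel_left _ ha).mp h)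

/-- `(W ∖ W_+) · W_+ ⊆ W ∖ W_+` (reissue p. 19). [cite: LanglandsShelstad1987, §2.5 (reissue p. 19)] -/
theorem mul_not_mem_plusW_right {a b : W} (ha' : a ∉ plusW π l) (hb : b ∈ plusW π l) :
    a * b ∉ plusW π l := by
  intro h
  exact ha' ((Subgroup.mul_mem_cancel_right _ hb).mp h)

/-- «define `u_i(w) ∈ W_±` by `w_i w = u_i(w) w_j`» (reissue p. 20): `u_i(w) ∈ W_±` for a section `y`. [cite:
LanglandsShelstad1987, §2.5 (reissue p. 20)] -/
theorem uFun_mem {y : W ⧸ pmW π l → W} (hy : ∀ i, (y i : W ⧸ pmW π l) = i) (i : W ⧸ pmW π l) (w : W) :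
    uFun π l y i w ∈ pmW π l := by
  have h := QuotientGroup.eq.mp (hy (↑(w⁻¹ * y i) : W ⧸ pmW π l)).symm
  simpa [uFun, mul_inv_rev, mul_assoc] using h

/-- The transfer relation `u_i(vw) = u_i(v) u_j(w)`, `j` the coset of `v⁻¹ y_i` (reissue p. 21: «`∏_i s(u_i(vw))^{λ_i} =
∏_i s(u_i(v)u_j(w))^{λ_i}`»). [cite: LanglandsShelstad1987, §2.5 (reissue p. 21)] -/
theorem uFun_mul {y : W ⧸ pmW π l → W} (hy : ∀ i, (y i : W ⧸ pmW π l) = i) (i : W ⧸ pmW π l) (v w : W) :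
    uFun π l y i (v * w) = uFun π l y i v * uFun π l y (↑(v⁻¹ * y i)) w := by
  have hidx : (↑(w⁻¹ * y (↑(v⁻¹ * y i) : W ⧸ pmW π l)) : W ⧸ pmW π l) = ↑((v * w)⁻¹ * y i) := by
    rw [QuotientGroup.eq]
    have h := QuotientGroup.eq.mp (hy (↑(v⁻¹ * y i) : W ⧸ pmW π l))
    simpa [mul_inv_rev, mul_assoc] using h
  simp only [uFun]
  rw [hidx]
  group

/-- `π(v) λ_j = π(y_i) π(u_i(v)) λ = ±λ_i` for `j` the coset of `v⁻¹ y_i` (reissue p. 21: «`σ_j σ = u_i(σ)⁻¹σ_i`»).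
[cite: LanglandsShelstad1987, §2.5 (reissue p. 21)] -/
theorem smul_lamOf {y : W ⧸ pmW π l → W} (i : W ⧸ pmW π l) (v : W) :
    π v • lamOf π l y (↑(v⁻¹ * y i)) = π (y i) • π (uFun π l y i v) • l := by
  simp only [lamOf, uFun, ← mul_smul, ← map_mul]
  congr 2
  group

variable {π l}

/-- `v_0(u) = v_0 u v_0⁻¹` for `u ∈ W_+` (reissue p. 20: «`v_0 u = v_0(u) v_i`, `i = 0`»). [cite: LanglandsShelstad1987,
§2.5 (reissue p. 20)] -/
theorem v0Fun_of_mem {v₀ v₁ u : W} (hu : u ∈ plusW π l) : v0Fun π l v₀ v₁ u = v₀ * u * v₀⁻¹ := by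
  unfold v0Fun; exact if_pos hu

/-- `v_0(u) = v_0 u v_1⁻¹` for `u ∉ W_+` (reissue p. 20: «`v_0 u = v_0(u) v_i`, `i = 1`»). [cite: LanglandsShelstad1987,
§2.5 (reissue p. 20)] -/
theorem v0Fun_of_not_mem {v₀ v₁ u : W} (hu : u ∉ plusW π l) : v0Fun π l v₀ v₁ u = v₀ * u * v₁⁻¹ := by
  unfold v0Fun; exact if_neg hu

/-- `Γ_{+λ} ≠ Γ_{±λ}` (i.e. `[F_+ : F_±] = 2`) as soon as `W_± ∖ W_+` is inhabited (reissue p. 19). [cite: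
LanglandsShelstad1987, §2.5 (reissue p. 19)] -/
theorem stab_ne_of_not_mem {u : W} (hu : u ∈ pmW π l) (hun : u ∉ plusW π l) : stabPlus Γ X l ≠ stabPM Γ X l := by
  intro h
  apply hun
  have : plusW π l = pmW π l := by simp only [plusW, pmW, h]
  rw [this]; exact hu

/-- `(ab)^λ = a^λ b^λ` in `k^× ⊗ X` (additively; the notation `a^λ` of reissue p. 11). [cite: LanglandsShelstad1987,
§2.1 (reissue p. 11)] -/
theorem unitPow_mul (a b : ℂˣ) (m : X) : unitPow (a * b) m = unitPow a m + unitPow b m := by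
  simp [unitPow, ofMul_mul, TensorProduct.tmul_add]

/-- `(a⁻¹)^λ = a^{−λ}` in `k^× ⊗ X` (additively; reissue p. 11). [cite: LanglandsShelstad1987, §2.1 (reissue p. 11)] -/
theorem unitPow_inv (a : ℂˣ) (m : X) : unitPow a⁻¹ m = unitPow a (-m) := by
  simp [unitPow, ofMul_inv, TensorProduct.tmul_neg, TensorProduct.neg_tmul]

/-- The claim of reissue p. 21 («`s(uv) = s(u)v_0 s(v)^{±1} v_0⁻¹ t(u,v)`») for ζ-data, first half: `s(uu') = s(u)s(u')`
for `u ∈ W_+`, `u' ∈ W_±` (`t = 1`). [cite: LanglandsShelstad1987, §2.5 (reissue p. 21)] -/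
theorem sFun_mul_of_mem {ζ : X → W → ℂˣ} {v₀ v₁ u u' : W}
    (hmul : ∀ u ∈ plusW π l, ∀ u' ∈ plusW π l, ζ l (u * u') = ζ l u * ζ l u')
    (hv₀ : v₀ ∈ plusW π l) (hv₁ : stabPlus Γ X l ≠ stabPM Γ X l → v₁ ∈ pmW π l ∧ v₁ ∉ plusW π l)
    (hu : u ∈ plusW π l) (hu' : u' ∈ pmW π l) :
    sFun π l ζ v₀ v₁ (u * u') = sFun π l ζ v₀ v₁ u * sFun π l ζ v₀ v₁ u' := by
  have hv₀' : v₀ ∈ pmW π l := plusW_le_pmW π l hv₀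
  have hA : v₀ * u * v₀⁻¹ ∈ plusW π l := conj_mem_plusW π l hv₀' hu
  by_cases hK : u' ∈ plusW π l
  · have huu : u * u' ∈ plusW π l := mul_mem hu hK
    simp only [sFun, v0Fun_of_mem huu, v0Fun_of_mem hu, v0Fun_of_mem hK]
    rw [← hmul _ hA _ (conj_mem_plusW π l hv₀' hK)]
    congr 1; group
  · obtain ⟨h1, h1'⟩ := hv₁ (stab_ne_of_not_mem hu' hK)
    have huu : u * u' ∉ plusW π l := mul_not_mem_plusW_left π l hu hK
    simp only [sFun, v0Fun_of_not_mem huu, v0Fun_of_mem hu, v0Fun_of_not_mem hK]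
    have hB : v₀ * u' * v₁⁻¹ ∈ plusW π l :=
      mul_mem_plusW_of_not_mem π l (mul_mem hv₀' hu') (mul_not_mem_plusW_left π l hv₀ hK) (inv_mem h1)
        (fun h => h1' ((Subgroup.inv_mem_iff _).mp h))
    rw [← hmul _ hA _ hB]
    congr 1; group

/-- The claim of reissue p. 21 for ζ-data, second half: `s(uu') = s(u)s(u')⁻¹` for `u ∈ W_± ∖ W_+`, `u' ∈ W_±` (the
factor `χ_λ(v_1² v_0⁻²) = −1` of p. 21 is `ζ_λ(v_1 v_0⁻¹ v_1 v_0⁻¹) = 1` here, by (iii) of `IsZetaDataW`). [cite: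
LanglandsShelstad1987, §2.5 (reissue p. 21)] -/
theorem sFun_mul_of_not_mem {ζ : X → W → ℂˣ} {v₀ v₁ u u' : W}
    (hmul : ∀ u ∈ plusW π l, ∀ u' ∈ plusW π l, ζ l (u * u') = ζ l u * ζ l u')
    (hinv : ∀ u ∈ plusW π l, ζ (-l) u = (ζ l u)⁻¹)
    (hconj : ∀ w : W, ∀ u ∈ plusW π l, ζ (π w • l) (w * u * w⁻¹) = ζ l u)
    (hsq : ∀ v ∈ pmW π l, v ∉ plusW π l → ζ l (v * v) = 1)
    (hv₀ : v₀ ∈ plusW π l) (hv₁ : stabPlus Γ X l ≠ stabPM Γ X l → v₁ ∈ pmW π l ∧ v₁ ∉ plusW π l)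
    (hu : u ∈ pmW π l) (hun : u ∉ plusW π l) (hu' : u' ∈ pmW π l) :
    sFun π l ζ v₀ v₁ (u * u') = sFun π l ζ v₀ v₁ u * (sFun π l ζ v₀ v₁ u')⁻¹ := by
  have hv₀' : v₀ ∈ pmW π l := plusW_le_pmW π l hv₀
  obtain ⟨h1, h1'⟩ := hv₁ (stab_ne_of_not_mem hu hun)
  have h1i : v₁⁻¹ ∉ plusW π l := fun h => h1' ((Subgroup.inv_mem_iff _).mp h)
  have conjK : ∀ g ∈ plusW π l, ∀ x ∈ plusW π l, ζ l (g * x * g⁻¹) = ζ l x := by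
    intro g hg x hx
    have h := hconj g x hx
    rwa [(mem_plusW_iff π l g).mp hg] at h
  have conjN : ∀ g ∈ pmW π l, g ∉ plusW π l → ∀ x ∈ plusW π l, ζ l (g * x * g⁻¹) = (ζ l x)⁻¹ := by
    intro g hg hg' x hx
    have h := hconj g x hx
    rw [smul_eq_neg_of_mem_pmW π l hg hg', hinv _ (conj_mem_plusW π l hg hx)] at h
    rw [← h, inv_inv]
  have hA : v₀ * u * v₁⁻¹ ∈ plusW π l :=
    mul_mem_plusW_of_not_mem π l (mul_mem hv₀' hu) (mul_not_mem_plusW_left π l hv₀ hun) (inv_mem h1) h1i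
  by_cases hK : u' ∈ plusW π l
  · have huu : u * u' ∉ plusW π l := mul_not_mem_plusW_right π l hun hK
    simp only [sFun, v0Fun_of_not_mem huu, v0Fun_of_not_mem hun, v0Fun_of_mem hK]
    have hB : v₁ * u' * v₁⁻¹ ∈ plusW π l := conj_mem_plusW π l h1 hK
    have : v₀ * (u * u') * v₁⁻¹ = (v₀ * u * v₁⁻¹) * (v₁ * u' * v₁⁻¹) := by group
    rw [this, hmul _ hA _ hB, conjN v₁ h1 h1' u' hK, conjK v₀ hv₀ u' hK]
  · have huu : u * u' ∈ plusW π l := mul_mem_plusW_of_not_mem π l hu hun hu' hK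
    simp only [sFun, v0Fun_of_mem huu, v0Fun_of_not_mem hun, v0Fun_of_not_mem hK]
    have hgm : v₁ * v₀⁻¹ ∈ pmW π l := mul_mem h1 (inv_mem hv₀')
    have hgn : v₁ * v₀⁻¹ ∉ plusW π l := mul_not_mem_plusW_right π l h1' (inv_mem hv₀)
    have hB0 : v₀ * u' * v₁⁻¹ ∈ plusW π l :=
      mul_mem_plusW_of_not_mem π l (mul_mem hv₀' hu') (mul_not_mem_plusW_left π l hv₀ hK) (inv_mem h1) h1i
    have hB : v₁ * v₀⁻¹ * (v₀ * u' * v₁⁻¹) * (v₁ * v₀⁻¹)⁻¹ ∈ plusW π l := conj_mem_plusW π l hgm hB0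
    have hC : v₁ * v₀⁻¹ * (v₁ * v₀⁻¹) ∈ plusW π l := mul_mem_plusW_of_not_mem π l hgm hgn hgm hgn
    have : v₀ * (u * u') * v₀⁻¹ =
        (v₀ * u * v₁⁻¹) * (v₁ * v₀⁻¹ * (v₀ * u' * v₁⁻¹) * (v₁ * v₀⁻¹)⁻¹) * (v₁ * v₀⁻¹ * (v₁ * v₀⁻¹)) := by
      group
    rw [this, hmul _ (mul_mem hA hB) _ hC, hmul _ hA _ hB, hsq _ hgm hgn, conjN _ hgm hgn _ hB0, mul_one]

end CocycleAux

/-- Discharge of `Corollary_2_5_B_cocycle` [cite: LanglandsShelstad1987, Corollary 2.5.B (reissue p. 22)]: `c` is a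
1-cocycle.  Printed proof followed (pp. 20–22 for `r_p`, read with `ζ` for `χ` so that the sign `t(u,v)` of the claim on
p. 21 is `1` and no `t_p` term appears): the transfer relation `u_i(vw) = u_i(v)u_j(w)` (`uFun_mul`), the claim
`s(uv) = s(u)s(v)^{±1}` (`sFun_mul_of_mem` ∕ `sFun_mul_of_not_mem`), `π(v)λ_j = ±λ_i` (`smul_lamOf`), and the
reindexing `i ↦ j` of the cosets `W ⧸ W_±` by `v⁻¹`. -/
theorem Corollary_2_5_B_cocycle_holds : Corollary_2_5_B_cocycle := by
  intro Γ _ _ X _ _ _ _ W _ π hπ R l ζ y v₀ v₁ _hR _hS hO hζ hc _hp v w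
  obtain ⟨hy, hv₀, hv₁⟩ := hc
  obtain ⟨hmul, hinv, hconj, hsq⟩ := hζ l hO.1
  haveI : Finite (W ⧸ pmW π l) := by
    haveI : (pmW π l).FiniteIndex := by
      refine ⟨?_⟩
      rw [pmW, Subgroup.index_comap_of_surjective _ hπ]
      exact Subgroup.index_ne_zero_of_finite
    infer_instance
  haveI : Fintype (W ⧸ pmW π l) := Fintype.ofFinite _
  have hj : ∀ i : W ⧸ pmW π l, (↑(v⁻¹ * y i) : W ⧸ pmW π l) = v⁻¹ • i := fun i => by
    have h := MulAction.Quotient.smul_coe (pmW π l) v⁻¹ (y i)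
    rw [hy i, smul_eq_mul] at h
    exact h.symm
  have step1 : ∀ i : W ⧸ pmW π l,
      unitPow (sFun π l ζ v₀ v₁ (uFun π l y i (v * w))) (lamOf π l y i) =
        unitPow (sFun π l ζ v₀ v₁ (uFun π l y i v)) (lamOf π l y i) +
          unitPow (sFun π l ζ v₀ v₁ (uFun π l y (↑(v⁻¹ * y i)) w)) (π (y i) • π (uFun π l y i v) • l) := by
    intro i
    rw [uFun_mul π l hy i v w]
    by_cases hK : uFun π l y i v ∈ plusW π l
    · rw [sFun_mul_of_mem hmul hv₀ hv₁ hK (uFun_mem π l hy _ w), unitPow_mul, (mem_plusW_iff π l _).mp hK, lamOf]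
    · rw [sFun_mul_of_not_mem hmul hinv hconj hsq hv₀ hv₁ (uFun_mem π l hy i v) hK (uFun_mem π l hy _ w),
        unitPow_mul, unitPow_inv, smul_eq_neg_of_mem_pmW π l (uFun_mem π l hy i v) hK, smul_neg, lamOf]
  simp only [cCochain, rCochain, finsum_eq_sum_of_fintype]
  rw [Finset.sum_congr rfl fun i _ => step1 i, Finset.sum_add_distrib, add_comm, Finset.smul_sum]
  congr 1
  refine Fintype.sum_equiv (MulAction.toPerm (v⁻¹ : W)) _ _ fun i => ?_
  rw [MulAction.toPerm_apply, ← hj i, ← smul_lamOf π l i v, unitPow, unitPow, TensorProduct.smul_tmul']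


/-! ### Lemma 2.5.A (reissue pp. 20–22): `∂r_q = t_q` — auxiliary identities of the printed proof, χ-data version -/

section ChiAux

variable {Γ : Type*} [Group Γ] {X : Type*} [AddCommGroup X] [DistribMulAction Γ X]
variable {W : Type*} [Group W] (π : W →* Γ) (l : X)

/-- `λ_i ∈ R` for `R` `Γ`-stable containing `λ` (reissue p. 20: «`λ_i = σ_i⁻¹λ`»). [cite: LanglandsShelstad1987, §2.5 (reissue p. 20)] -/
theorem lamOf_mem {R : Finset X} (hR : IsStable Γ X R) (hl : l ∈ R) (y : W ⧸ pmW π l → W) (i : W ⧸ pmW π l) :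
    lamOf π l y i ∈ R :=
  hR _ _ hl

/-- The gauge `p` of the construction: `p(λ′) = 1 ↔ λ′ = λ_i` for some `i` (reissue p. 20). [cite: LanglandsShelstad1987, §2.5 (reissue p. 20)] -/
theorem gaugeOfSection_eq_one_iff (y : W ⧸ pmW π l → W) (m : X) :
    gaugeOfSection π l y m = 1 ↔ ∃ i : W ⧸ pmW π l, m = lamOf π l y i := by
  simp only [gaugeOfSection]
  by_cases h : ∃ i : W ⧸ pmW π l, m = lamOf π l y i
  · rw [if_pos h]; exact iff_of_true rfl h
  · rw [if_neg h]; simp only [h, iff_false]; decide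

/-- `p(−λ_i) = −1` when the `p` of the construction is a gauge on a `Γ`-stable `R ∋ λ` (reissue p. 20). [cite: LanglandsShelstad1987, §2.5 (reissue p. 20)] -/
theorem gaugeOfSection_neg_lamOf {R : Finset X} (hR : IsStable Γ X R) (hl : l ∈ R) {y : W ⧸ pmW π l → W}
    (hp : IsGauge R (gaugeOfSection π l y)) (i : W ⧸ pmW π l) :
    gaugeOfSection π l y (-lamOf π l y i) = -1 := by
  rw [hp _ (lamOf_mem π l hR hl y i), (gaugeOfSection_eq_one_iff π l y _).mpr ⟨i, rfl⟩]

/-- `π(v)⁻¹λ_i = π(y_j)π(u_i(v))⁻¹λ`, `j` the coset of `v⁻¹y_i` (reissue p. 21: «`σ_jσ = u_i(σ)⁻¹σ_i`»).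
[cite: LanglandsShelstad1987, §2.5 (reissue p. 21)] -/
theorem inv_smul_lamOf (y : W ⧸ pmW π l → W) (i : W ⧸ pmW π l) (v : W) :
    (π v)⁻¹ • lamOf π l y i = π (y (↑(v⁻¹ * y i))) • (π (uFun π l y i v))⁻¹ • l := by
  simp only [lamOf, uFun, ← mul_smul, ← map_inv, ← map_mul]
  congr 2
  group

/-- `π(u)⁻¹λ = λ` for `u ∈ W_+` (reissue p. 19). [cite: LanglandsShelstad1987, §2.5 (reissue p. 19)] -/
theorem inv_smul_of_mem {u : W} (hu : u ∈ plusW π l) : (π u)⁻¹ • l = l := by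
  rw [inv_smul_eq_iff, (mem_plusW_iff π l u).mp hu]

/-- `π(u)⁻¹λ = −λ` for `u ∈ W_± ∖ W_+` (reissue p. 19). [cite: LanglandsShelstad1987, §2.5 (reissue p. 19)] -/
theorem inv_smul_of_not_mem {u : W} (hu : u ∈ pmW π l) (hun : u ∉ plusW π l) : (π u)⁻¹ • l = -l := by
  rw [inv_smul_eq_iff, smul_neg, smul_eq_neg_of_mem_pmW π l hu hun, neg_neg]

/-- The `λ_i` are pairwise distinct: `i ↦ λ_i` is injective on `W ⧸ W_±` (reissue p. 20: the `σ_i` represent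
`Γ_±\Γ`). [cite: LanglandsShelstad1987, §2.5 (reissue p. 20)] -/
theorem lamOf_injective {y : W ⧸ pmW π l → W} (hy : ∀ i, (y i : W ⧸ pmW π l) = i) :
    Function.Injective (lamOf π l y) := by
  intro i k h
  have hmem : (y k)⁻¹ * y i ∈ pmW π l := by
    refine plusW_le_pmW π l ?_
    rw [mem_plusW_iff, map_mul, map_inv, mul_smul, inv_smul_eq_iff]
    exact h
  calc i = ↑(y i) := (hy i).symm
    _ = ↑(y k) := (QuotientGroup.eq.mpr hmem).symm
    _ = k := hy k

variable {π l}

/-- The claim of reissue p. 21, case `u ∈ W_± ∖ W_+`, `u' ∈ W_+`: `s(uu') = s(u)s(u')⁻¹` (χ- or ζ-data: only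
(i), (ii) are used). [cite: LanglandsShelstad1987, §2.5 (reissue p. 21)] -/
theorem sFun_mul_of_not_mem_of_mem {ζ : X → W → ℂˣ} {v₀ v₁ u u' : W}
    (hmul : ∀ u ∈ plusW π l, ∀ u' ∈ plusW π l, ζ l (u * u') = ζ l u * ζ l u')
    (hinv : ∀ u ∈ plusW π l, ζ (-l) u = (ζ l u)⁻¹)
    (hconj : ∀ w : W, ∀ u ∈ plusW π l, ζ (π w • l) (w * u * w⁻¹) = ζ l u)
    (hv₀ : v₀ ∈ plusW π l) (hv₁ : stabPlus Γ X l ≠ stabPM Γ X l → v₁ ∈ pmW π l ∧ v₁ ∉ plusW π l)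
    (hu : u ∈ pmW π l) (hun : u ∉ plusW π l) (hK : u' ∈ plusW π l) :
    sFun π l ζ v₀ v₁ (u * u') = sFun π l ζ v₀ v₁ u * (sFun π l ζ v₀ v₁ u')⁻¹ := by
  have hv₀' : v₀ ∈ pmW π l := plusW_le_pmW π l hv₀
  obtain ⟨h1, h1'⟩ := hv₁ (stab_ne_of_not_mem hu hun)
  have h1i : v₁⁻¹ ∉ plusW π l := fun h => h1' ((Subgroup.inv_mem_iff _).mp h)
  have conjK : ∀ g ∈ plusW π l, ∀ x ∈ plusW π l, ζ l (g * x * g⁻¹) = ζ l x := by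
    intro g hg x hx
    have h := hconj g x hx
    rwa [(mem_plusW_iff π l g).mp hg] at h
  have conjN : ∀ g ∈ pmW π l, g ∉ plusW π l → ∀ x ∈ plusW π l, ζ l (g * x * g⁻¹) = (ζ l x)⁻¹ := by
    intro g hg hg' x hx
    have h := hconj g x hx
    rw [smul_eq_neg_of_mem_pmW π l hg hg', hinv _ (conj_mem_plusW π l hg hx)] at h
    rw [← h, inv_inv]
  have hA : v₀ * u * v₁⁻¹ ∈ plusW π l :=
    mul_mem_plusW_of_not_mem π l (mul_mem hv₀' hu) (mul_not_mem_plusW_left π l hv₀ hun) (inv_mem h1) h1i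
  have huu : u * u' ∉ plusW π l := mul_not_mem_plusW_right π l hun hK
  simp only [sFun, v0Fun_of_not_mem huu, v0Fun_of_not_mem hun, v0Fun_of_mem hK]
  have hB : v₁ * u' * v₁⁻¹ ∈ plusW π l := conj_mem_plusW π l h1 hK
  have : v₀ * (u * u') * v₁⁻¹ = (v₀ * u * v₁⁻¹) * (v₁ * u' * v₁⁻¹) := by group
  rw [this, hmul _ hA _ hB, conjN v₁ h1 h1' u' hK, conjK v₀ hv₀ u' hK]

/-- The claim of reissue p. 21, case `u, u' ∈ W_± ∖ W_+`: `s(uu') = s(u)s(u')⁻¹·e` where `e` is the common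
value of the data on squares of `W_± ∖ W_+` (`e = χ_λ(v_1²v_0⁻²) = −1` for χ-data, (iii); `e = 1` for ζ-data).
[cite: LanglandsShelstad1987, §2.5 (reissue p. 21)] -/
theorem sFun_mul_of_not_mem_of_not_mem {ζ : X → W → ℂˣ} {v₀ v₁ u u' : W} {e : ℂˣ}
    (hmul : ∀ u ∈ plusW π l, ∀ u' ∈ plusW π l, ζ l (u * u') = ζ l u * ζ l u')
    (hinv : ∀ u ∈ plusW π l, ζ (-l) u = (ζ l u)⁻¹)
    (hconj : ∀ w : W, ∀ u ∈ plusW π l, ζ (π w • l) (w * u * w⁻¹) = ζ l u)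
    (hsq : ∀ v ∈ pmW π l, v ∉ plusW π l → ζ l (v * v) = e)
    (hv₀ : v₀ ∈ plusW π l) (hv₁ : stabPlus Γ X l ≠ stabPM Γ X l → v₁ ∈ pmW π l ∧ v₁ ∉ plusW π l)
    (hu : u ∈ pmW π l) (hun : u ∉ plusW π l) (hu' : u' ∈ pmW π l) (hK : u' ∉ plusW π l) :
    sFun π l ζ v₀ v₁ (u * u') = sFun π l ζ v₀ v₁ u * (sFun π l ζ v₀ v₁ u')⁻¹ * e := by
  have hv₀' : v₀ ∈ pmW π l := plusW_le_pmW π l hv₀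
  obtain ⟨h1, h1'⟩ := hv₁ (stab_ne_of_not_mem hu hun)
  have h1i : v₁⁻¹ ∉ plusW π l := fun h => h1' ((Subgroup.inv_mem_iff _).mp h)
  have conjN : ∀ g ∈ pmW π l, g ∉ plusW π l → ∀ x ∈ plusW π l, ζ l (g * x * g⁻¹) = (ζ l x)⁻¹ := by
    intro g hg hg' x hx
    have h := hconj g x hx
    rw [smul_eq_neg_of_mem_pmW π l hg hg', hinv _ (conj_mem_plusW π l hg hx)] at h
    rw [← h, inv_inv]
  have hA : v₀ * u * v₁⁻¹ ∈ plusW π l :=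
    mul_mem_plusW_of_not_mem π l (mul_mem hv₀' hu) (mul_not_mem_plusW_left π l hv₀ hun) (inv_mem h1) h1i
  have huu : u * u' ∈ plusW π l := mul_mem_plusW_of_not_mem π l hu hun hu' hK
  simp only [sFun, v0Fun_of_mem huu, v0Fun_of_not_mem hun, v0Fun_of_not_mem hK]
  have hgm : v₁ * v₀⁻¹ ∈ pmW π l := mul_mem h1 (inv_mem hv₀')
  have hgn : v₁ * v₀⁻¹ ∉ plusW π l := mul_not_mem_plusW_right π l h1' (inv_mem hv₀)
  have hB0 : v₀ * u' * v₁⁻¹ ∈ plusW π l :=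
    mul_mem_plusW_of_not_mem π l (mul_mem hv₀' hu') (mul_not_mem_plusW_left π l hv₀ hK) (inv_mem h1) h1i
  have hB : v₁ * v₀⁻¹ * (v₀ * u' * v₁⁻¹) * (v₁ * v₀⁻¹)⁻¹ ∈ plusW π l := conj_mem_plusW π l hgm hB0
  have hC : v₁ * v₀⁻¹ * (v₁ * v₀⁻¹) ∈ plusW π l := mul_mem_plusW_of_not_mem π l hgm hgn hgm hgn
  have : v₀ * (u * u') * v₀⁻¹ =
      (v₀ * u * v₁⁻¹) * (v₁ * v₀⁻¹ * (v₀ * u' * v₁⁻¹) * (v₁ * v₀⁻¹)⁻¹) * (v₁ * v₀⁻¹ * (v₁ * v₀⁻¹)) := by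
    group
  rw [this, hmul _ (mul_mem hA hB) _ hC, hmul _ hA _ hB, hsq _ hgm hgn, conjN _ hgm hgn _ hB0]

/-- `(−1)^λ` is 2-torsion in `k^× ⊗ X`: `−(−1)^λ = (−1)^λ` (additively; reissue p. 11). [cite: LanglandsShelstad1987, §2.1 (reissue p. 11)] -/
theorem neg_unitPow_neg_one (m : X) : -unitPow (-1 : ℂˣ) m = unitPow (-1 : ℂˣ) m := by
  rw [neg_eq_iff_add_eq_zero, unitPow, ← TensorProduct.tmul_add, ← ofMul_mul, neg_mul_neg, one_mul, ofMul_one,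
    TensorProduct.tmul_zero]

end ChiAux

/-- Discharge of `Lemma_2_5_A` [cite: LanglandsShelstad1987, Lemma 2.5.A (reissue p. 20)]: «The coboundary of `r_q`
is `t_q`.»  Printed proof followed (pp. 20–22): `r_q = s_{q/p} r_p` and `∂s_{q/p} = t_q t_p⁻¹` (Lemma 2.4.A, ★
`Lemma_2_4_A_holds`), so it suffices that `∂r_p = t_p`; by the transfer relation `u_i(vw) = u_i(v)u_j(w)` and the
p. 21 claim `s(uv) = s(u)v_0 s(v)^{±1}v_0⁻¹ t(u,v)` (`t(u,v) = −1` iff `u, v ∉ W_+`, from (iii)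
`χ_λ(v_1²v_0⁻²) = −1`), `∂r_p(v,w) = ∏_{i : u_i(v) ∉ W_+, u_j(w) ∉ W_+} (−1)^{λ_i}`, and this index set is exactly
print's `{i : p(λ_i) = 1, p(σ⁻¹λ_i) = −1, p(τ⁻¹σ⁻¹λ_i) = 1}` (pp. 21–22), i.e. the sum is `t_p(π v, π w)`. -/
theorem Lemma_2_5_A_holds : Lemma_2_5_A := by
  intro Γ _ _ X _ _ _ _ W _ π hπ R l χ y v₀ v₁ q hR hS hO hχ hc hp hq v w
  classical
  obtain ⟨hy, hv₀, hv₁⟩ := hc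
  obtain ⟨hmul, hinv, hconj, hsq⟩ := hχ l hO.1
  haveI : Finite (W ⧸ pmW π l) := by
    haveI : (pmW π l).FiniteIndex := by
      refine ⟨?_⟩
      rw [pmW, Subgroup.index_comap_of_surjective _ hπ]
      exact Subgroup.index_ne_zero_of_finite
    infer_instance
  haveI : Fintype (W ⧸ pmW π l) := Fintype.ofFinite _
  have h11 : (1 : ℤˣ) ≠ -1 := by decide
  have hj : ∀ i : W ⧸ pmW π l, (↑(v⁻¹ * y i) : W ⧸ pmW π l) = v⁻¹ • i := fun i => by
    have h := MulAction.Quotient.smul_coe (pmW π l) v⁻¹ (y i)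
    rw [hy i, smul_eq_mul] at h
    exact h.symm
  -- the three kinds of terms
  set T : W → W ⧸ pmW π l → UnitsTensor X ℂ := fun x i =>
    unitPow (sFun π l χ v₀ v₁ (uFun π l y i x)) (lamOf π l y i) with hT
  set I : W ⧸ pmW π l → Prop := fun i =>
    uFun π l y i v ∉ plusW π l ∧ uFun π l y (↑(v⁻¹ * y i)) w ∉ plusW π l with hI
  have step1 : ∀ i : W ⧸ pmW π l, T (v * w) i =
      T v i + unitPow (sFun π l χ v₀ v₁ (uFun π l y (↑(v⁻¹ * y i)) w)) (π (y i) • π (uFun π l y i v) • l) +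
        (if I i then unitPow (-1 : ℂˣ) (lamOf π l y i) else 0) := by
    intro i
    simp only [hT, hI]
    rw [uFun_mul π l hy i v w]
    by_cases hK : uFun π l y i v ∈ plusW π l
    · rw [sFun_mul_of_mem hmul hv₀ hv₁ hK (uFun_mem π l hy _ w), unitPow_mul, (mem_plusW_iff π l _).mp hK, lamOf,
        if_neg (fun h => h.1 hK), add_zero]
    · by_cases hK' : uFun π l y (↑(v⁻¹ * y i)) w ∈ plusW π l
      · rw [sFun_mul_of_not_mem_of_mem hmul hinv hconj hv₀ hv₁ (uFun_mem π l hy i v) hK hK', unitPow_mul,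
          unitPow_inv, smul_eq_neg_of_mem_pmW π l (uFun_mem π l hy i v) hK, smul_neg, lamOf,
          if_neg (fun h => h.2 hK'), add_zero]
      · rw [sFun_mul_of_not_mem_of_not_mem hmul hinv hconj hsq hv₀ hv₁ (uFun_mem π l hy i v) hK
            (uFun_mem π l hy _ w) hK', unitPow_mul, unitPow_mul, unitPow_inv,
          smul_eq_neg_of_mem_pmW π l (uFun_mem π l hy i v) hK, smul_neg, lamOf, if_pos ⟨hK, hK'⟩]
  -- π(v)·r_p(w), reindexed by `i ↦ j`
  have hB : ∑ i, unitPow (sFun π l χ v₀ v₁ (uFun π l y (↑(v⁻¹ * y i)) w)) (π (y i) • π (uFun π l y i v) • l) =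
      π v • ∑ i, T w i := by
    rw [Finset.smul_sum]
    refine Fintype.sum_equiv (MulAction.toPerm (v⁻¹ : W)) _ _ fun i => ?_
    simp only [MulAction.toPerm_apply, hT]
    rw [← hj i, ← smul_lamOf π l i v, unitPow, unitPow, TensorProduct.smul_tmul']
  -- the defect sum is `t_p(π v, π w)`
  have hD : ∑ i, (if I i then unitPow (-1 : ℂˣ) (lamOf π l y i) else 0) =
      tCochain Γ ℂ R (gaugeOfSection π l y) (π v, π w) := by
    rw [← Finset.sum_filter, tCochain]
    rw [← Finset.sum_image (f := fun m => unitPow (-1 : ℂˣ) m) fun i _ k _ h => lamOf_injective π l hy h]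
    refine Finset.sum_congr ?_ fun _ _ => rfl
    ext m
    simp only [Finset.mem_image, Finset.mem_filter, Finset.mem_univ, true_and]
    constructor
    · rintro ⟨i, ⟨hi1, hi2⟩, rfl⟩
      refine ⟨lamOf_mem π l hR hO.1 y i, (gaugeOfSection_eq_one_iff π l y _).mpr ⟨i, rfl⟩, ?_, ?_⟩
      · rw [inv_smul_lamOf π l y i v, inv_smul_of_not_mem π l (uFun_mem π l hy i v) hi1, smul_neg]
        exact gaugeOfSection_neg_lamOf π l hR hO.1 hp _
      · rw [inv_smul_lamOf π l y i v, inv_smul_of_not_mem π l (uFun_mem π l hy i v) hi1, smul_neg, smul_neg,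
          ← lamOf, inv_smul_lamOf π l y _ w, inv_smul_of_not_mem π l (uFun_mem π l hy _ w) hi2, smul_neg, neg_neg]
        exact (gaugeOfSection_eq_one_iff π l y _).mpr ⟨_, rfl⟩
    · rintro ⟨hm, hp1, hp2, hp3⟩
      obtain ⟨i, rfl⟩ := (gaugeOfSection_eq_one_iff π l y m).mp hp1
      have hi1 : uFun π l y i v ∉ plusW π l := by
        intro hK
        rw [inv_smul_lamOf π l y i v, inv_smul_of_mem π l hK, ← lamOf,
          (gaugeOfSection_eq_one_iff π l y _).mpr ⟨_, rfl⟩] at hp2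
        exact h11 hp2
      have hi2 : uFun π l y (↑(v⁻¹ * y i)) w ∉ plusW π l := by
        intro hK'
        rw [inv_smul_lamOf π l y i v, inv_smul_of_not_mem π l (uFun_mem π l hy i v) hi1, smul_neg, smul_neg,
          ← lamOf, inv_smul_lamOf π l y _ w, inv_smul_of_mem π l hK', ← lamOf,
          gaugeOfSection_neg_lamOf π l hR hO.1 hp] at hp3
        exact h11 hp3.symm
      exact ⟨i, ⟨hi1, hi2⟩, rfl⟩
  -- `∂r_p = t_p`
  have hr : π v • rCochain π l χ y v₀ v₁ w - rCochain π l χ y v₀ v₁ (v * w) + rCochain π l χ y v₀ v₁ v =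
      tCochain Γ ℂ R (gaugeOfSection π l y) (π v, π w) := by
    have e1 : ∀ x, rCochain π l χ y v₀ v₁ x = ∑ i, T x i := fun x => by
      simp only [rCochain, finsum_eq_sum_of_fintype, hT]
    rw [e1, e1, e1, Finset.sum_congr rfl fun i _ => step1 i, Finset.sum_add_distrib, Finset.sum_add_distrib, hB,
      hD]
    have h2 : -tCochain Γ ℂ R (gaugeOfSection π l y) (π v, π w) = tCochain Γ ℂ R (gaugeOfSection π l y) (π v, π w) := by
      simp only [tCochain]
      rw [← Finset.sum_neg_distrib]
      exact Finset.sum_congr rfl fun μ _ => neg_unitPow_neg_one μ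
    calc _ = -tCochain Γ ℂ R (gaugeOfSection π l y) (π v, π w) := by abel
      _ = _ := h2
  -- `∂s_{q/p} = t_q − t_p` (Lemma 2.4.A) and assembly
  have hs := Lemma_2_4_A_holds ℂ R q (gaugeOfSection π l y) hR hS hq hp (π v) (π w)
  simp only [rqCochain, map_mul, smul_add]
  calc π v • sCochain ℂ R q (gaugeOfSection π l y) (π w) + π v • rCochain π l χ y v₀ v₁ w -
        (sCochain ℂ R q (gaugeOfSection π l y) (π v * π w) + rCochain π l χ y v₀ v₁ (v * w)) +
        (sCochain ℂ R q (gaugeOfSection π l y) (π v) + rCochain π l χ y v₀ v₁ v)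
      = (π v • sCochain ℂ R q (gaugeOfSection π l y) (π w) - sCochain ℂ R q (gaugeOfSection π l y) (π v * π w) +
          sCochain ℂ R q (gaugeOfSection π l y) (π v)) +
        (π v • rCochain π l χ y v₀ v₁ w - rCochain π l χ y v₀ v₁ (v * w) + rCochain π l χ y v₀ v₁ v) := by
        abel
    _ = tCochain Γ ℂ R q (π v, π w) := by rw [hs, hr, sub_add_cancel]

end Discharges

/-! ## ED. 5 discharges: Corollary 2.4.B (i), (ii) (reissue p. 19) by explicit 0-cochains

Print (p. 19): «In view of Lemma 2.4.A both `s_{q/p}s_{p/q}⁻¹` and `s_{p/q}s_{q/r}s_{p/r}⁻¹` are cocycles. We can then reduce in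
the usual way with Shapiro's Lemma to the case `R = {±λ}`. Then `q, r = ±p` and the lemma is clear.»  Unwinding the
Shapiro reduction gives EXPLICIT coboundary witnesses, which we use instead (no appeal to Lemma 2.4.A or to the lattice
hypotheses is then needed): with `(−1)^{−λ} = (−1)^λ` of order `2`, collect `s_{q/p} − s_{p/q}` (resp.
`s_{p/q} + s_{q/r} − s_{p/r}`) over the pairs `±λ ⊂ R`; the pair `±λ` contributes `(−1)^λ` exactly when
`p(λ)q(λ) ≠ p(σ⁻¹λ)q(σ⁻¹λ)` (resp. when `θ(λ) ≠ θ(σ⁻¹λ)`, `θ(λ) := [p(λ)q(λ) = −1 = q(λ)r(λ)]`), which is the coboundary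
of `x = ∑_{λ ∈ R : p(λ) = 1, q(λ) = −1} (−1)^λ` (resp. `x = ∑_{λ ∈ R : p(λ) = 1, q(λ) = −1, r(λ) = 1} (−1)^λ`).  The
verification is the same finite sign count as ★ `KeyLemmasI.cobd_splitCochain` (pair `λ ↔ −λ`, 16 resp. 64 sign cases). -/

section DischargesED5

variable {Γ : Type*} [Group Γ] {X : Type*} [AddCommGroup X] [DistribMulAction Γ X]

/-- `(−1)^m · (−1)^m = 1` in `k^× ⊗ X` (additively `= 0`). [folklore] -/
private theorem unitPow_negOne_add_self (k : Type*) [Field k] (m : X) :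
    unitPow (-1 : kˣ) m + unitPow (-1 : kˣ) m = 0 := by
  simp only [unitPow, ← TensorProduct.tmul_add, ← ofMul_mul]
  simp

/-- `2·(−1)^m = 0` in `k^× ⊗ X`. [folklore] -/
private theorem two_zsmul_unitPow_negOne (k : Type*) [Field k] (m : X) : (2 : ℤ) • unitPow (-1 : kˣ) m = 0 := by
  rw [two_zsmul]
  exact unitPow_negOne_add_self k m

/-- `(−1)^{−m} = (−1)^m` in `k^× ⊗ X`. [folklore] -/
private theorem unitPow_negOne_neg (k : Type*) [Field k] (m : X) : unitPow (-1 : kˣ) (-m) = unitPow (-1 : kˣ) m := by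
  rw [← sub_eq_zero, unitPow, unitPow, TensorProduct.neg_tmul, sub_eq_add_neg, ← neg_add, neg_eq_zero]
  exact unitPow_negOne_add_self k m

/-- `σ·a^λ = a^{σλ}`: `Γ` acts on `k^× ⊗ X` through `X`. [folklore] -/
private theorem smul_unitPow_eq (k : Type*) [Field k] (σ : Γ) (a : kˣ) (l : X) :
    σ • unitPow a l = unitPow a (σ • l) := by
  simp [unitPow, TensorProduct.smul_tmul']

/-- Re-indexing: `σ · ∑_{λ ∈ R, c(λ)} (−1)^λ = ∑_{μ ∈ R, c(σ⁻¹μ)} (−1)^μ` for `R` `Γ`-stable. [folklore] -/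
private theorem smul_sum_filter_unitPow (k : Type*) [Field k] (R : Finset X) (hst : IsStable Γ X R)
    (c : X → Prop) [DecidablePred c] (σ : Γ) :
    σ • (∑ l ∈ R with c l, unitPow (-1 : kˣ) l) = ∑ m ∈ R with c (σ⁻¹ • m), unitPow (-1 : kˣ) m := by
  rw [Finset.smul_sum]
  simp only [smul_unitPow_eq]
  apply Finset.sum_nbij' (fun l => σ • l) (fun m => σ⁻¹ • m)
  · intro l hl
    simp only [Finset.mem_filter] at hl ⊢
    exact ⟨hst σ l hl.1, by simpa [inv_smul_smul] using hl.2⟩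
  · intro m hm
    simp only [Finset.mem_filter] at hm ⊢
    exact ⟨hst σ⁻¹ m hm.1, hm.2⟩
  · intro l _
    simp
  · intro m _
    simp
  · intro l _
    simp

/-- **Corollary 2.4.B (i) holds**: `s_{q/p} − s_{p/q} = ∂x` with `x = ∑_{λ ∈ R : p(λ) = 1, q(λ) = −1} (−1)^λ`.
[cite: LanglandsShelstad1987, Corollary 2.4.B (reissue p. 19)] -/
theorem Corollary_2_4_B_i_holds : Corollary_2_4_B_i := by
  intro Γ _ X _ _ _ _ k _ _ R p q hst hsy hp hq
  refine ⟨∑ l ∈ R with (p l = 1 ∧ q l = -1), unitPow (-1 : kˣ) l, fun σ => ?_⟩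
  rw [smul_sum_filter_unitPow k R hst _ σ]
  simp only [sCochain, Finset.sum_filter]
  rw [← sub_eq_zero]
  simp only [← Finset.sum_sub_distrib, ← Finset.sum_add_distrib]
  have c1 : (-1 : ℤˣ) ≠ 1 := by decide
  have c2 : (1 : ℤˣ) ≠ -1 := by decide
  refine Finset.sum_involution (fun m _ => -m) ?_ ?_ ?_ ?_
  · intro m hm
    have hg : σ⁻¹ • m ∈ R := hst σ⁻¹ m hm
    have e1 : p (-m) = -p m := hp m hm
    have e2 : p (σ⁻¹ • -m) = -p (σ⁻¹ • m) := by rw [smul_neg]; exact hp _ hg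
    have f1 : q (-m) = -q m := hq m hm
    have f2 : q (σ⁻¹ • -m) = -q (σ⁻¹ • m) := by rw [smul_neg]; exact hq _ hg
    rw [e1, e2, f1, f2, unitPow_negOne_neg k m]
    rcases Int.units_eq_one_or (p m) with k1 | k1 <;>
    rcases Int.units_eq_one_or (p (σ⁻¹ • m)) with k2 | k2 <;>
    rcases Int.units_eq_one_or (q m) with k3 | k3 <;>
    rcases Int.units_eq_one_or (q (σ⁻¹ • m)) with k4 | k4 <;>
      (simp [k1, k2, k3, k4, c1, c2, unitPow_negOne_add_self]; try (abel_nf; simp [two_zsmul_unitPow_negOne]))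
  · intro m hm _ hmm
    have := hp m hm
    rw [hmm] at this
    exact units_ne_neg_self (p m) this
  · intro m hm
    exact hsy m hm
  · intro m _
    simp

/-- **Corollary 2.4.B (ii) holds**: `s_{p/q} + s_{q/r} − s_{p/r} = ∂x` with
`x = ∑_{λ ∈ R : p(λ) = 1, q(λ) = −1, r(λ) = 1} (−1)^λ`. [cite: LanglandsShelstad1987, Corollary 2.4.B (reissue p. 19)] -/
theorem Corollary_2_4_B_ii_holds : Corollary_2_4_B_ii := by
  intro Γ _ X _ _ _ _ k _ _ R p q r hst hsy hp hq hr
  refine ⟨∑ l ∈ R with (p l = 1 ∧ q l = -1 ∧ r l = 1), unitPow (-1 : kˣ) l, fun σ => ?_⟩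
  rw [smul_sum_filter_unitPow k R hst _ σ]
  simp only [sCochain, Finset.sum_filter]
  rw [← sub_eq_zero]
  simp only [← Finset.sum_sub_distrib, ← Finset.sum_add_distrib]
  have c1 : (-1 : ℤˣ) ≠ 1 := by decide
  have c2 : (1 : ℤˣ) ≠ -1 := by decide
  refine Finset.sum_involution (fun m _ => -m) ?_ ?_ ?_ ?_
  · intro m hm
    have hg : σ⁻¹ • m ∈ R := hst σ⁻¹ m hm
    have e1 : p (-m) = -p m := hp m hm
    have e2 : p (σ⁻¹ • -m) = -p (σ⁻¹ • m) := by rw [smul_neg]; exact hp _ hg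
    have f1 : q (-m) = -q m := hq m hm
    have f2 : q (σ⁻¹ • -m) = -q (σ⁻¹ • m) := by rw [smul_neg]; exact hq _ hg
    have g1 : r (-m) = -r m := hr m hm
    have g2 : r (σ⁻¹ • -m) = -r (σ⁻¹ • m) := by rw [smul_neg]; exact hr _ hg
    rw [e1, e2, f1, f2, g1, g2, unitPow_negOne_neg k m]
    rcases Int.units_eq_one_or (p m) with k1 | k1 <;>
    rcases Int.units_eq_one_or (p (σ⁻¹ • m)) with k2 | k2 <;>
    rcases Int.units_eq_one_or (q m) with k3 | k3 <;>
    rcases Int.units_eq_one_or (q (σ⁻¹ • m)) with k4 | k4 <;>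
    rcases Int.units_eq_one_or (r m) with k5 | k5 <;>
    rcases Int.units_eq_one_or (r (σ⁻¹ • m)) with k6 | k6 <;>
      (simp [k1, k2, k3, k4, k5, k6, c1, c2, unitPow_negOne_add_self];
        try (abel_nf; simp [two_zsmul_unitPow_negOne]))
  · intro m hm _ hmm
    have := hp m hm
    rw [hmm] at this
    exact units_ne_neg_self (p m) this
  · intro m hm
    exact hsy m hm
  · intro m _
    simp

end DischargesED5

/-! ## ED. 6 discharges: independence of the choices (reissue p. 22) — `Remark_2_5_indep`, `Corollary_2_5_B_indep`

Print (p. 22): «It remains to check that the various choices made have no effect on `r_q`, up to 1-coboundaries. …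
Consider a change in `v_0, v_1`. Then `r_p` is replaced by a cochain `r′_p`. To show that the cocycle `r_p r′_p⁻¹` is
trivial we may assume `X` is free on `{λ ∈ R : p(λ) = 1}` and reduce to the case `R = {±λ}` by Shapiro's Lemma. It is
sufficient now to observe that `r_p` and `r′_p` coincide on `W_+`, for then `r_p r′_p⁻¹` defines an element of
`H¹(Gal(F_+/F_±), ℂ^× ⊗ X)`. This group is readily seen to be trivial.  Another choice `w′_1, …, w′_n` … leads to a gauge
`p′` and it has to be shown that the cocycle `s_{p′/p} r_p r′_{p′}⁻¹` is trivial. Again we reduce to the case `R = {±λ}` …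
Finally, replacing `λ` by `−λ` clearly has no effect. If we replace `λ` by `λ′ = κλ` and `v ∈ W` is a lifting of `κ` then …
we set `w′_i = v w_i` … `v′_0 = v v_0 v⁻¹` … Since `χ_{λ′}(vxv⁻¹) = χ_λ(x)` the independence is clear.»
The tree has no Shapiro's Lemma for these explicit cochains, so the two Shapiro reductions are UNWOUND into the explicit
0-cochains they produce («`H¹(Gal(F_+/F_±), ℂ^×) = 0`» = square roots in `ℂ^×`): with `λ_i`, `u_i(w)`, `s` as in (2.5),
(V) a change `(v_0, v_1) ↦ (v′_0, v′_1)` multiplies `s(u)` by `d = χ_λ(v′_0v_0⁻¹)χ_λ(v′_1v_1⁻¹)⁻¹` exactly when `u ∉ W_+`,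
and `r′_p − r_p = ∂(Σ_i c^{λ_i})` for any `c` with `c⁻² = d`; (S) a change of section `w_i ↦ w′_i` (`y′_i = y_i h_i`,
`h_i ∈ W_±`, gauge `p′`) gives, term by term from the p. 21 claim, `r′_{p′} − r_p − s_{p′/p}∘π = ∂(Σ_i s(h_i)^{λ_i} +
Σ_{i : h_i ∉ W_+} (−1)^{λ_i})`; (T) a change of base point `λ ↦ λ′ = ±κλ` is print's conjugation transport, an EQUALITY of
cochains after reindexing `W∕W_{±λ′} ≃ W∕W_{±λ}`; the three are glued with ★ `Corollary_2_4_B_ii_holds` and ★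
`Remark_2_4_trivial_holds` (`s_{q/p} − s_{q/p′} − s_{p′/p}` is a coboundary).  The ζ-version (Corollary 2.5.B) is the same
computation with the sign `e = ζ_λ(v_1²v_0⁻²) = 1`, where all `(−1)`-terms vanish and no gauge enters. -/

section DischargesED6

variable {Γ : Type*} [Group Γ] {X : Type*} [AddCommGroup X] [DistribMulAction Γ X]
variable {W : Type*} [Group W] {π : W →* Γ} {l : X}

/-! ### Small algebra of `s(u) = χ_λ(v_0(u))` (reissue pp. 20–21) -/

/-- `χ_λ(1) = 1` from multiplicativity (i). [cite: LanglandsShelstad1987, §2.5 (reissue p. 19)] -/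
private theorem chi_one {ζ : X → W → ℂˣ}
    (hmul : ∀ u ∈ plusW π l, ∀ u' ∈ plusW π l, ζ l (u * u') = ζ l u * ζ l u') : ζ l 1 = 1 := by
  have h := hmul 1 (one_mem _) 1 (one_mem _)
  rw [mul_one] at h
  exact mul_eq_left.mp h.symm

/-- `χ_λ(u⁻¹) = χ_λ(u)⁻¹` on `W_+` from (i). [cite: LanglandsShelstad1987, §2.5 (reissue p. 19)] -/
private theorem chi_inv {ζ : X → W → ℂˣ}
    (hmul : ∀ u ∈ plusW π l, ∀ u' ∈ plusW π l, ζ l (u * u') = ζ l u * ζ l u') {u : W} (hu : u ∈ plusW π l) :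
    ζ l u⁻¹ = (ζ l u)⁻¹ := by
  have h := hmul u hu u⁻¹ (inv_mem hu)
  rw [mul_inv_cancel, chi_one hmul] at h
  exact eq_inv_of_mul_eq_one_right h.symm

/-- `s(u) = χ_λ(u)` for `u ∈ W_+` (reissue p. 20: `v_0(u) = v_0uv_0⁻¹` and `χ_λ` is invariant under `W_+`-conjugation by
(ii)). [cite: LanglandsShelstad1987, §2.5 (reissue p. 20)] -/
private theorem sFun_of_mem {ζ : X → W → ℂˣ} {v₀ v₁ u : W}
    (hconj : ∀ w : W, ∀ u ∈ plusW π l, ζ (π w • l) (w * u * w⁻¹) = ζ l u) (hv₀ : v₀ ∈ plusW π l)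
    (hu : u ∈ plusW π l) : sFun π l ζ v₀ v₁ u = ζ l u := by
  simp only [sFun, v0Fun_of_mem hu]
  have h := hconj v₀ u hu
  rwa [(mem_plusW_iff π l v₀).mp hv₀] at h

/-- `s(h⁻¹) = s(h)⁻¹` for `h ∈ W_+`. [cite: LanglandsShelstad1987, §2.5 (reissue p. 21)] -/
private theorem sFun_inv_of_mem {ζ : X → W → ℂˣ} {v₀ v₁ h : W}
    (hmul : ∀ u ∈ plusW π l, ∀ u' ∈ plusW π l, ζ l (u * u') = ζ l u * ζ l u')
    (hconj : ∀ w : W, ∀ u ∈ plusW π l, ζ (π w • l) (w * u * w⁻¹) = ζ l u) (hv₀ : v₀ ∈ plusW π l)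
    (hh : h ∈ plusW π l) : sFun π l ζ v₀ v₁ h⁻¹ = (sFun π l ζ v₀ v₁ h)⁻¹ := by
  rw [sFun_of_mem hconj hv₀ (inv_mem hh), sFun_of_mem hconj hv₀ hh, chi_inv hmul hh]

/-- `s(h⁻¹) = s(h)·e⁻¹` for `h ∈ W_± ∖ W_+`, `e` the value of the data on squares of `W_± ∖ W_+` (from the p. 21 claim at
`(h⁻¹, h)` and `s(1) = 1`). [cite: LanglandsShelstad1987, §2.5 (reissue p. 21)] -/
private theorem sFun_inv_of_not_mem {ζ : X → W → ℂˣ} {v₀ v₁ h : W} {e : ℂˣ}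
    (hmul : ∀ u ∈ plusW π l, ∀ u' ∈ plusW π l, ζ l (u * u') = ζ l u * ζ l u')
    (hinv : ∀ u ∈ plusW π l, ζ (-l) u = (ζ l u)⁻¹)
    (hconj : ∀ w : W, ∀ u ∈ plusW π l, ζ (π w • l) (w * u * w⁻¹) = ζ l u)
    (hsq : ∀ v ∈ pmW π l, v ∉ plusW π l → ζ l (v * v) = e)
    (hv₀ : v₀ ∈ plusW π l) (hv₁ : stabPlus Γ X l ≠ stabPM Γ X l → v₁ ∈ pmW π l ∧ v₁ ∉ plusW π l)
    (hh : h ∈ pmW π l) (hhn : h ∉ plusW π l) : sFun π l ζ v₀ v₁ h⁻¹ = sFun π l ζ v₀ v₁ h * e⁻¹ := by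
  have hhi : h⁻¹ ∈ pmW π l := inv_mem hh
  have hhni : h⁻¹ ∉ plusW π l := fun hc => hhn ((Subgroup.inv_mem_iff _).mp hc)
  have h1 := sFun_mul_of_not_mem_of_not_mem hmul hinv hconj hsq hv₀ hv₁ hhi hhni hh hhn
  rw [inv_mul_cancel, sFun_of_mem hconj hv₀ (one_mem _), chi_one hmul] at h1
  -- `1 = s(h⁻¹) s(h)⁻¹ e`
  have : sFun π l ζ v₀ v₁ h⁻¹ = (((sFun π l ζ v₀ v₁ h)⁻¹) * e)⁻¹ := by
    rw [eq_inv_iff_mul_eq_one, ← mul_assoc]; exact h1.symm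
  rw [this, mul_inv_rev, inv_inv, mul_comm]

/-- `a^{−m}` for `a⁻¹`: `unitPow a⁻¹ (−m) = unitPow a m`. [folklore] -/
private theorem unitPow_inv_neg (a : ℂˣ) (m : X) : unitPow a⁻¹ (-m) = unitPow a m := by
  rw [unitPow_inv, neg_neg]

/-- `unitPow 1 m = 0`. [folklore] -/
private theorem unitPow_one (m : X) : unitPow (1 : ℂˣ) m = 0 := by
  simp [unitPow]

/-- `unitPow a (-m) = - unitPow a m`. [folklore] -/
private theorem unitPow_neg (a : ℂˣ) (m : X) : unitPow a (-m) = -unitPow a m := by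
  simp [unitPow, TensorProduct.neg_tmul]

/-! ### (V) change of `v_0, v_1` (reissue p. 22, first reduction) -/

/-- For `u ∈ W_+`, `s` does not depend on `(v_0, v_1)`. [cite: LanglandsShelstad1987, §2.5 (reissue p. 22)] -/
private theorem sFun_vChange_of_mem {ζ : X → W → ℂˣ} {v₀ v₁ v₀' v₁' u : W}
    (hconj : ∀ w : W, ∀ u ∈ plusW π l, ζ (π w • l) (w * u * w⁻¹) = ζ l u)
    (hv₀ : v₀ ∈ plusW π l) (hv₀' : v₀' ∈ plusW π l) (hu : u ∈ plusW π l) :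
    sFun π l ζ v₀' v₁' u = sFun π l ζ v₀ v₁ u := by
  rw [sFun_of_mem hconj hv₀ hu, sFun_of_mem hconj hv₀' hu]

/-- For `u ∈ W_± ∖ W_+`, `s′(u) = s(u)·d` with `d = χ_λ(v′_0v_0⁻¹)·χ_λ(v′_1v_1⁻¹)⁻¹` (reissue p. 22: «`r_p` and `r′_p`
coincide on `W_+`», and off `W_+` they differ by this constant). [cite: LanglandsShelstad1987, §2.5 (reissue p. 22)] -/
private theorem sFun_vChange_of_not_mem {ζ : X → W → ℂˣ} {v₀ v₁ v₀' v₁' u : W}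
    (hmul : ∀ u ∈ plusW π l, ∀ u' ∈ plusW π l, ζ l (u * u') = ζ l u * ζ l u')
    (hv₀ : v₀ ∈ plusW π l) (hv₁ : stabPlus Γ X l ≠ stabPM Γ X l → v₁ ∈ pmW π l ∧ v₁ ∉ plusW π l)
    (hv₀' : v₀' ∈ plusW π l) (hv₁' : stabPlus Γ X l ≠ stabPM Γ X l → v₁' ∈ pmW π l ∧ v₁' ∉ plusW π l)
    (hu : u ∈ pmW π l) (hun : u ∉ plusW π l) :
    sFun π l ζ v₀' v₁' u = sFun π l ζ v₀ v₁ u * (ζ l (v₀' * v₀⁻¹) * (ζ l (v₁' * v₁⁻¹))⁻¹) := by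
  obtain ⟨h1, h1'⟩ := hv₁ (stab_ne_of_not_mem hu hun)
  obtain ⟨h2, h2'⟩ := hv₁' (stab_ne_of_not_mem hu hun)
  have hv₀m : v₀ ∈ pmW π l := plusW_le_pmW π l hv₀
  have h1i : v₁⁻¹ ∉ plusW π l := fun h => h1' ((Subgroup.inv_mem_iff _).mp h)
  have hA : v₀ * u * v₁⁻¹ ∈ plusW π l :=
    mul_mem_plusW_of_not_mem π l (mul_mem hv₀m hu) (mul_not_mem_plusW_left π l hv₀ hun) (inv_mem h1) h1i
  have hB : v₀' * v₀⁻¹ ∈ plusW π l := mul_mem hv₀' (inv_mem hv₀)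
  have hC : v₁' * v₁⁻¹ ∈ plusW π l := mul_mem_plusW_of_not_mem π l h2 h2' (inv_mem h1) h1i
  have hC' : v₁ * v₁'⁻¹ ∈ plusW π l := by
    have := inv_mem hC; rwa [mul_inv_rev, inv_inv] at this
  simp only [sFun, v0Fun_of_not_mem hun]
  have e1 : v₀' * u * v₁'⁻¹ = (v₀' * v₀⁻¹) * (v₀ * u * v₁⁻¹) * (v₁ * v₁'⁻¹) := by group
  rw [e1, hmul _ (mul_mem hB hA) _ hC', hmul _ hB _ hA]
  have e2 : v₁ * v₁'⁻¹ = (v₁' * v₁⁻¹)⁻¹ := by group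
  rw [e2, chi_inv hmul hC]
  ac_rfl

/-- A square root in `ℂ^×`: every `d` is `c⁻¹·c⁻¹` for some `c` («`H¹(Gal(F_+/F_±), ℂ^× ⊗ X)` … is readily seen to be
trivial», reissue p. 22). [folklore] -/
private theorem exists_inv_sq_eq (d : ℂˣ) : ∃ c : ℂˣ, c⁻¹ * c⁻¹ = d := by
  obtain ⟨z, hz⟩ := IsAlgClosed.exists_pow_nat_eq ((d⁻¹ : ℂˣ) : ℂ) (by norm_num : 0 < 2)
  have hz0 : z ≠ 0 := by
    rintro rfl
    rw [zero_pow (by norm_num)] at hz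
    exact (d⁻¹).ne_zero hz.symm
  refine ⟨Units.mk0 z hz0, ?_⟩
  rw [← mul_inv, inv_eq_iff_eq_inv]
  ext
  rw [Units.val_mul, Units.val_mk0, ← pow_two, hz]

/-- `W∕W_±` is finite when `Γ` is finite and `π` is onto (reissue p. 20: «representatives `σ_1, …, σ_n` for `Γ_±\Γ`»).
[cite: LanglandsShelstad1987, §2.5 (reissue p. 20)] -/
private theorem finite_quot [Finite Γ] (hπ : Function.Surjective π) (l : X) : Finite (W ⧸ pmW π l) := by
  haveI : (pmW π l).FiniteIndex := by
    refine ⟨?_⟩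
    rw [pmW, Subgroup.index_comap_of_surjective _ hπ]
    exact Subgroup.index_ne_zero_of_finite
  infer_instance

/-- The coset of `x⁻¹y_i` is `x⁻¹·i` (reissue p. 20: `w_i w = u_i(w) w_j`). [cite: LanglandsShelstad1987, §2.5 (reissue p. 20)] -/
private theorem coset_inv_mul {y : W ⧸ pmW π l → W} (hy : ∀ i, (y i : W ⧸ pmW π l) = i) (x : W)
    (i : W ⧸ pmW π l) : (↑(x⁻¹ * y i) : W ⧸ pmW π l) = x⁻¹ • i := by
  have h := MulAction.Quotient.smul_coe (pmW π l) x⁻¹ (y i)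
  rw [hy i, smul_eq_mul] at h
  exact h.symm

/-- Reindexing `i ↦ j`: `π(x)·Σ_i a_i^{λ_i} = Σ_i a_j^{π(y_i)π(u_i(x))λ}` for any coefficients `a` indexed by the cosets
(the step «`r_p(v) v(r_p(w))`» of reissue p. 21). [cite: LanglandsShelstad1987, §2.5 (reissue p. 21)] -/
private theorem smul_sum_unitPow_lamOf [Fintype (W ⧸ pmW π l)] {y : W ⧸ pmW π l → W}
    (hy : ∀ i, (y i : W ⧸ pmW π l) = i) (a : W ⧸ pmW π l → ℂˣ) (x : W) :
    π x • ∑ i, unitPow (a i) (lamOf π l y i) =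
      ∑ i, unitPow (a (↑(x⁻¹ * y i))) (π (y i) • π (uFun π l y i x) • l) := by
  rw [Finset.smul_sum]
  symm
  refine Fintype.sum_equiv (MulAction.toPerm (x⁻¹ : W)) _ _ fun i => ?_
  simp only [MulAction.toPerm_apply]
  rw [← coset_inv_mul hy x i, ← smul_lamOf π l i x, unitPow, unitPow, TensorProduct.smul_tmul']

/-- **(V)** (reissue p. 22, «Consider a change in `v_0, v_1` …»): `r′_p − r_p = ∂(Σ_i c^{λ_i})` with `c⁻² = d`,
`d = χ_λ(v′_0v_0⁻¹)χ_λ(v′_1v_1⁻¹)⁻¹` — print's «`r_p` and `r′_p` coincide on `W_+`» plus the explicit square root replacing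
«`H¹(Gal(F_+/F_±), ℂ^× ⊗ X)` is trivial».  Uses only (i) and the conjugation half of (ii), so it serves χ- and ζ-data alike.
[cite: LanglandsShelstad1987, §2.5 (reissue p. 22)] -/
private theorem rCochain_vChange [Finite Γ] (hπ : Function.Surjective π) {ζ : X → W → ℂˣ}
    {y : W ⧸ pmW π l → W} {v₀ v₁ v₀' v₁' : W}
    (hmul : ∀ u ∈ plusW π l, ∀ u' ∈ plusW π l, ζ l (u * u') = ζ l u * ζ l u')
    (hconj : ∀ w : W, ∀ u ∈ plusW π l, ζ (π w • l) (w * u * w⁻¹) = ζ l u)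
    (hy : ∀ i, (y i : W ⧸ pmW π l) = i) (hv₀ : v₀ ∈ plusW π l)
    (hv₁ : stabPlus Γ X l ≠ stabPM Γ X l → v₁ ∈ pmW π l ∧ v₁ ∉ plusW π l) (hv₀' : v₀' ∈ plusW π l)
    (hv₁' : stabPlus Γ X l ≠ stabPM Γ X l → v₁' ∈ pmW π l ∧ v₁' ∉ plusW π l) :
    ∃ m : UnitsTensor X ℂ, ∀ x : W,
      rCochain π l ζ y v₀' v₁' x - rCochain π l ζ y v₀ v₁ x = π x • m - m := by
  classical
  haveI := finite_quot hπ l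
  haveI : Fintype (W ⧸ pmW π l) := Fintype.ofFinite _
  set d : ℂˣ := ζ l (v₀' * v₀⁻¹) * (ζ l (v₁' * v₁⁻¹))⁻¹ with hd
  obtain ⟨c, hc⟩ := exists_inv_sq_eq d
  refine ⟨∑ i, unitPow c (lamOf π l y i), fun x => ?_⟩
  -- both sides equal the «defect» `Σ_{i : u_i(x) ∉ W_+} d^{λ_i}`
  have key : ∀ i : W ⧸ pmW π l,
      unitPow (sFun π l ζ v₀' v₁' (uFun π l y i x)) (lamOf π l y i) -
          unitPow (sFun π l ζ v₀ v₁ (uFun π l y i x)) (lamOf π l y i) =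
        unitPow (c) (π (y i) • π (uFun π l y i x) • l) - unitPow c (lamOf π l y i) := by
    intro i
    by_cases hK : uFun π l y i x ∈ plusW π l
    · rw [sFun_vChange_of_mem hconj hv₀ hv₀' hK, (mem_plusW_iff π l _).mp hK, ← lamOf, sub_self, sub_self]
    · rw [sFun_vChange_of_not_mem hmul hv₀ hv₁ hv₀' hv₁' (uFun_mem π l hy i x) hK, ← hd, unitPow_mul,
        smul_eq_neg_of_mem_pmW π l (uFun_mem π l hy i x) hK, smul_neg, ← lamOf, unitPow_neg, ← hc, unitPow_mul,
        unitPow_inv, unitPow_neg]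
      abel
  simp only [rCochain, finsum_eq_sum_of_fintype]
  rw [smul_sum_unitPow_lamOf hy (fun _ => c) x, ← Finset.sum_sub_distrib, ← Finset.sum_sub_distrib]
  exact Finset.sum_congr rfl fun i _ => key i

/-! ### (S) change of the section `w_i ↦ w′_i` (reissue p. 22, second reduction): `y′_i = y_i h_i`, `h_i ∈ W_±` -/

/-- `λ′_i = π(y_i)π(h_i)λ` for the section `y′ = y·h`. [cite: LanglandsShelstad1987, §2.5 (reissue p. 22)] -/
private theorem lamOf_mulSec (y h : W ⧸ pmW π l → W) (i : W ⧸ pmW π l) :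
    lamOf π l (fun k => y k * h k) i = π (y i) • π (h i) • l := by
  simp [lamOf, mul_smul]

/-- The coset `j` of `x⁻¹y′_i` is that of `x⁻¹y_i`. [cite: LanglandsShelstad1987, §2.5 (reissue p. 22)] -/
private theorem coset_mulSec {y h : W ⧸ pmW π l → W} (hh : ∀ k, h k ∈ pmW π l) (x : W) (i : W ⧸ pmW π l) :
    (↑(x⁻¹ * (y i * h i)) : W ⧸ pmW π l) = ↑(x⁻¹ * y i) := by
  rw [QuotientGroup.eq]
  have : (x⁻¹ * (y i * h i))⁻¹ * (x⁻¹ * y i) = (h i)⁻¹ := by group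
  rw [this]
  exact inv_mem (hh i)

/-- `u′_i(x) = h_i⁻¹ u_i(x) h_j` for `y′ = y·h` (reissue p. 22: «`u′_1(w) = v_1wv_1⁻¹`» in the case `R = {±λ}`).
[cite: LanglandsShelstad1987, §2.5 (reissue p. 22)] -/
private theorem uFun_mulSec {y h : W ⧸ pmW π l → W} (hh : ∀ k, h k ∈ pmW π l) (x : W) (i : W ⧸ pmW π l) :
    uFun π l (fun k => y k * h k) i x = (h i)⁻¹ * uFun π l y i x * h (↑(x⁻¹ * y i)) := by
  simp only [uFun]
  rw [coset_mulSec hh x i]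
  group

/-- `y′ = y·h` is again a section. [cite: LanglandsShelstad1987, §2.5 (reissue p. 22)] -/
private theorem mulSec_section {y h : W ⧸ pmW π l → W} (hy : ∀ i, (y i : W ⧸ pmW π l) = i)
    (hh : ∀ k, h k ∈ pmW π l) (i : W ⧸ pmW π l) : ((y i * h i : W) : W ⧸ pmW π l) = i := by
  conv_rhs => rw [← hy i]
  rw [QuotientGroup.eq]
  have : (y i * h i)⁻¹ * y i = (h i)⁻¹ := by group
  rw [this]; exact inv_mem (hh i)

/-- **The term-by-term effect of a change of section** (reissue p. 22 with the p. 21 claim): for `y′ = y·h` and any data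
with `ζ_λ(v²) = e` on `W_± ∖ W_+`, `e² = 1` (`e = −1`: χ-data; `e = 1`: ζ-data),
`s(u′_i)^{λ′_i} = s(u_i)^{λ_i} − s(h_i)^{λ_i} + s(h_j)^{π(y_i)π(u_i)λ} + X_i`, where `X_i`, an integer multiple of `e^{λ_i}`,
collects the signs of the claim in the eight cases `h_i, u_i, h_j ∈ W_+` or not (coefficients `1, −1, −2, −2` on the cases
`(∈,∉,∉)`, `(∉,∈,∈)`, `(∉,∈,∉)`, `(∉,∉,∈)`, `0` otherwise). [cite: LanglandsShelstad1987, §2.5 (reissue pp. 21–22)] -/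
private theorem term_mulSec [DecidablePred (· ∈ plusW π l)] {ζ : X → W → ℂˣ} {y h : W ⧸ pmW π l → W}
    {v₀ v₁ : W} {e : ℂˣ}
    (hmul : ∀ u ∈ plusW π l, ∀ u' ∈ plusW π l, ζ l (u * u') = ζ l u * ζ l u')
    (hinv : ∀ u ∈ plusW π l, ζ (-l) u = (ζ l u)⁻¹)
    (hconj : ∀ w : W, ∀ u ∈ plusW π l, ζ (π w • l) (w * u * w⁻¹) = ζ l u)
    (hsq : ∀ v ∈ pmW π l, v ∉ plusW π l → ζ l (v * v) = e) (he : e⁻¹ = e)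
    (hv₀ : v₀ ∈ plusW π l) (hv₁ : stabPlus Γ X l ≠ stabPM Γ X l → v₁ ∈ pmW π l ∧ v₁ ∉ plusW π l)
    (hy : ∀ i, (y i : W ⧸ pmW π l) = i) (hh : ∀ k, h k ∈ pmW π l) (x : W) (i : W ⧸ pmW π l) :
    unitPow (sFun π l ζ v₀ v₁ (uFun π l (fun k => y k * h k) i x)) (lamOf π l (fun k => y k * h k) i) =
      unitPow (sFun π l ζ v₀ v₁ (uFun π l y i x)) (lamOf π l y i)
      - unitPow (sFun π l ζ v₀ v₁ (h i)) (lamOf π l y i)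
      + unitPow (sFun π l ζ v₀ v₁ (h (↑(x⁻¹ * y i)))) (π (y i) • π (uFun π l y i x) • l)
      + ((if h i ∈ plusW π l ∧ uFun π l y i x ∉ plusW π l ∧ h (↑(x⁻¹ * y i)) ∉ plusW π l
            then unitPow e (lamOf π l y i) else 0)
        - (if h i ∉ plusW π l ∧ uFun π l y i x ∈ plusW π l ∧ h (↑(x⁻¹ * y i)) ∈ plusW π l
            then unitPow e (lamOf π l y i) else 0)
        - (if h i ∉ plusW π l ∧ uFun π l y i x ∈ plusW π l ∧ h (↑(x⁻¹ * y i)) ∉ plusW π l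
            then unitPow e (lamOf π l y i) + unitPow e (lamOf π l y i) else 0)
        - (if h i ∉ plusW π l ∧ uFun π l y i x ∉ plusW π l ∧ h (↑(x⁻¹ * y i)) ∈ plusW π l
            then unitPow e (lamOf π l y i) + unitPow e (lamOf π l y i) else 0)) := by
  rw [uFun_mulSec hh x i, lamOf_mulSec]
  set a := h i with ha
  set b := h (↑(x⁻¹ * y i) : W ⧸ pmW π l) with hb
  set u := uFun π l y i x with hu
  have haM : a ∈ pmW π l := hh i
  have hbM : b ∈ pmW π l := hh _
  have huM : u ∈ pmW π l := uFun_mem π l hy i x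
  have hubM : u * b ∈ pmW π l := mul_mem huM hbM
  rw [mul_assoc]
  by_cases hA : a ∈ plusW π l
  · -- `h_i ∈ W_+`: `λ′_i = λ_i`, `s(a⁻¹(ub)) = s(a)⁻¹ s(ub)`
    rw [(mem_plusW_iff π l a).mp hA, ← lamOf, sFun_mul_of_mem hmul hv₀ hv₁ (inv_mem hA) hubM,
      sFun_inv_of_mem hmul hconj hv₀ hA]
    by_cases hU : u ∈ plusW π l
    · rw [sFun_mul_of_mem hmul hv₀ hv₁ hU hbM, (mem_plusW_iff π l u).mp hU, ← lamOf]
      by_cases hB : b ∈ plusW π l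
      · rw [if_neg (show ¬(a ∈ plusW π l ∧ u ∉ plusW π l ∧ b ∉ plusW π l) from fun h => h.2.1 hU),
          if_neg (show ¬(a ∉ plusW π l ∧ u ∈ plusW π l ∧ b ∈ plusW π l) from fun h => h.1 hA),
          if_neg (show ¬(a ∉ plusW π l ∧ u ∈ plusW π l ∧ b ∉ plusW π l) from fun h => h.1 hA),
          if_neg (show ¬(a ∉ plusW π l ∧ u ∉ plusW π l ∧ b ∈ plusW π l) from fun h => h.1 hA)]
        simp only [unitPow_mul, unitPow_inv, unitPow_neg]
        abel
      · rw [if_neg (show ¬(a ∈ plusW π l ∧ u ∉ plusW π l ∧ b ∉ plusW π l) from fun h => h.2.1 hU),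
          if_neg (show ¬(a ∉ plusW π l ∧ u ∈ plusW π l ∧ b ∈ plusW π l) from fun h => h.1 hA),
          if_neg (show ¬(a ∉ plusW π l ∧ u ∈ plusW π l ∧ b ∉ plusW π l) from fun h => h.1 hA),
          if_neg (show ¬(a ∉ plusW π l ∧ u ∉ plusW π l ∧ b ∈ plusW π l) from fun h => h.1 hA)]
        simp only [unitPow_mul, unitPow_inv, unitPow_neg]
        abel
    · rw [smul_eq_neg_of_mem_pmW π l huM hU, smul_neg, ← lamOf]
      by_cases hB : b ∈ plusW π l
      · rw [sFun_mul_of_not_mem_of_mem hmul hinv hconj hv₀ hv₁ huM hU hB]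
        rw [if_neg (show ¬(a ∈ plusW π l ∧ u ∉ plusW π l ∧ b ∉ plusW π l) from fun h => h.2.2 hB),
          if_neg (show ¬(a ∉ plusW π l ∧ u ∈ plusW π l ∧ b ∈ plusW π l) from fun h => h.1 hA),
          if_neg (show ¬(a ∉ plusW π l ∧ u ∈ plusW π l ∧ b ∉ plusW π l) from fun h => h.1 hA),
          if_neg (show ¬(a ∉ plusW π l ∧ u ∉ plusW π l ∧ b ∈ plusW π l) from fun h => h.1 hA)]
        simp only [unitPow_mul, unitPow_inv, unitPow_neg]
        abel
      · rw [sFun_mul_of_not_mem_of_not_mem hmul hinv hconj hsq hv₀ hv₁ huM hU hbM hB]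
        rw [if_pos (show a ∈ plusW π l ∧ u ∉ plusW π l ∧ b ∉ plusW π l from ⟨hA, hU, hB⟩),
          if_neg (show ¬(a ∉ plusW π l ∧ u ∈ plusW π l ∧ b ∈ plusW π l) from fun h => h.1 hA),
          if_neg (show ¬(a ∉ plusW π l ∧ u ∈ plusW π l ∧ b ∉ plusW π l) from fun h => h.1 hA),
          if_neg (show ¬(a ∉ plusW π l ∧ u ∉ plusW π l ∧ b ∈ plusW π l) from fun h => h.1 hA)]
        simp only [unitPow_mul, unitPow_inv, unitPow_neg]
        abel
  · -- `h_i ∉ W_+`: `λ′_i = −λ_i`, `s(a⁻¹) = s(a)e`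
    rw [smul_eq_neg_of_mem_pmW π l haM hA, smul_neg, ← lamOf]
    have haI : a⁻¹ ∈ pmW π l := inv_mem haM
    have haIn : a⁻¹ ∉ plusW π l := fun hc => hA ((Subgroup.inv_mem_iff _).mp hc)
    have hsa : sFun π l ζ v₀ v₁ a⁻¹ = sFun π l ζ v₀ v₁ a * e := by
      rw [sFun_inv_of_not_mem hmul hinv hconj hsq hv₀ hv₁ haM hA, he]
    by_cases hU : u ∈ plusW π l
    · rw [(mem_plusW_iff π l u).mp hU, ← lamOf]
      by_cases hB : b ∈ plusW π l
      · have hUB : u * b ∈ plusW π l := mul_mem hU hB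
        rw [sFun_mul_of_not_mem_of_mem hmul hinv hconj hv₀ hv₁ haI haIn hUB, hsa,
          sFun_mul_of_mem hmul hv₀ hv₁ hU hbM]
        rw [if_neg (show ¬(a ∈ plusW π l ∧ u ∉ plusW π l ∧ b ∉ plusW π l) from fun h => hA h.1),
          if_pos (show a ∉ plusW π l ∧ u ∈ plusW π l ∧ b ∈ plusW π l from ⟨hA, hU, hB⟩),
          if_neg (show ¬(a ∉ plusW π l ∧ u ∈ plusW π l ∧ b ∉ plusW π l) from fun h => h.2.2 hB),
          if_neg (show ¬(a ∉ plusW π l ∧ u ∉ plusW π l ∧ b ∈ plusW π l) from fun h => h.2.1 hU)]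
        simp only [unitPow_mul, unitPow_inv, unitPow_neg]
        abel
      · have hUB : u * b ∉ plusW π l := mul_not_mem_plusW_left π l hU hB
        rw [sFun_mul_of_not_mem_of_not_mem hmul hinv hconj hsq hv₀ hv₁ haI haIn hubM hUB, hsa,
          sFun_mul_of_mem hmul hv₀ hv₁ hU hbM]
        rw [if_neg (show ¬(a ∈ plusW π l ∧ u ∉ plusW π l ∧ b ∉ plusW π l) from fun h => hA h.1),
          if_neg (show ¬(a ∉ plusW π l ∧ u ∈ plusW π l ∧ b ∈ plusW π l) from fun h => hB h.2.2),
          if_pos (show a ∉ plusW π l ∧ u ∈ plusW π l ∧ b ∉ plusW π l from ⟨hA, hU, hB⟩),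
          if_neg (show ¬(a ∉ plusW π l ∧ u ∉ plusW π l ∧ b ∈ plusW π l) from fun h => h.2.1 hU)]
        simp only [unitPow_mul, unitPow_inv, unitPow_neg]
        abel
    · rw [smul_eq_neg_of_mem_pmW π l huM hU, smul_neg, ← lamOf]
      by_cases hB : b ∈ plusW π l
      · have hUB : u * b ∉ plusW π l := mul_not_mem_plusW_right π l hU hB
        rw [sFun_mul_of_not_mem_of_not_mem hmul hinv hconj hsq hv₀ hv₁ haI haIn hubM hUB, hsa,
          sFun_mul_of_not_mem_of_mem hmul hinv hconj hv₀ hv₁ huM hU hB]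
        rw [if_neg (show ¬(a ∈ plusW π l ∧ u ∉ plusW π l ∧ b ∉ plusW π l) from fun h => hA h.1),
          if_neg (show ¬(a ∉ plusW π l ∧ u ∈ plusW π l ∧ b ∈ plusW π l) from fun h => hU h.2.1),
          if_neg (show ¬(a ∉ plusW π l ∧ u ∈ plusW π l ∧ b ∉ plusW π l) from fun h => hU h.2.1),
          if_pos (show a ∉ plusW π l ∧ u ∉ plusW π l ∧ b ∈ plusW π l from ⟨hA, hU, hB⟩)]
        simp only [unitPow_mul, unitPow_inv, unitPow_neg]
        abel
      · have hUB : u * b ∈ plusW π l := mul_mem_plusW_of_not_mem π l huM hU hbM hB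
        rw [sFun_mul_of_not_mem_of_mem hmul hinv hconj hv₀ hv₁ haI haIn hUB, hsa,
          sFun_mul_of_not_mem_of_not_mem hmul hinv hconj hsq hv₀ hv₁ huM hU hbM hB]
        rw [if_neg (show ¬(a ∈ plusW π l ∧ u ∉ plusW π l ∧ b ∉ plusW π l) from fun h => hA h.1),
          if_neg (show ¬(a ∉ plusW π l ∧ u ∈ plusW π l ∧ b ∈ plusW π l) from fun h => hU h.2.1),
          if_neg (show ¬(a ∉ plusW π l ∧ u ∈ plusW π l ∧ b ∉ plusW π l) from fun h => hU h.2.1),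
          if_neg (show ¬(a ∉ plusW π l ∧ u ∉ plusW π l ∧ b ∈ plusW π l) from fun h => hB h.2.2)]
        simp only [unitPow_mul, unitPow_inv, unitPow_neg]
        abel

/-! ### (S), continued: the gauge `p′` of `y′ = y·h` and the identification of `Σ_i F_i` with `s_{p′/p}(π x)` -/

/-- Every element of the `Σ`-orbit `R` is `±λ_i` (reissue p. 20: «`±σ_1⁻¹λ, …, ±σ_n⁻¹λ` are the elements of `R` listed without
redundancy»). [cite: LanglandsShelstad1987, §2.5 (reissue p. 20)] -/
private theorem exists_eq_lamOf_or_neg (hπ : Function.Surjective π) {R : Finset X} (hO : IsSigmaOrbitOf Γ R l)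
    {y : W ⧸ pmW π l → W} (hy : ∀ i, (y i : W ⧸ pmW π l) = i) {m : X} (hm : m ∈ R) :
    ∃ i : W ⧸ pmW π l, m = lamOf π l y i ∨ m = -lamOf π l y i := by
  have key : ∀ σ : Γ, ∃ i : W ⧸ pmW π l, σ • l = lamOf π l y i ∨ σ • l = -lamOf π l y i := by
    intro σ
    obtain ⟨w, rfl⟩ := hπ σ
    refine ⟨(w : W ⧸ pmW π l), ?_⟩
    have hk : w⁻¹ * y (w : W ⧸ pmW π l) ∈ pmW π l := QuotientGroup.eq.mp (hy _).symm
    have e1 : lamOf π l y (w : W ⧸ pmW π l) = π w • π (w⁻¹ * y (w : W ⧸ pmW π l)) • l := by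
      rw [lamOf, ← mul_smul, ← map_mul]; congr 2; group
    by_cases hk' : w⁻¹ * y (w : W ⧸ pmW π l) ∈ plusW π l
    · left; rw [e1, (mem_plusW_iff π l _).mp hk']
    · right; rw [e1, smul_eq_neg_of_mem_pmW π l hk hk', smul_neg, neg_neg]
  rcases (hO.2 m).mp hm with ⟨σ, rfl⟩ | ⟨σ, rfl⟩
  · exact key σ
  · obtain ⟨i, hi | hi⟩ := key σ
    · exact ⟨i, Or.inr (by rw [hi])⟩
    · exact ⟨i, Or.inl (by rw [hi, neg_neg])⟩

/-- `λ_i ≠ −λ_k` when the `p` of the construction is a gauge (`p(λ_i) = 1`, `p(−λ_k) = −1`). [cite: LanglandsShelstad1987, §2.5 (reissue p. 20)] -/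
private theorem lamOf_ne_neg_lamOf {R : Finset X} (hR : IsStable Γ X R) (hl : l ∈ R) {y : W ⧸ pmW π l → W}
    (hp : IsGauge R (gaugeOfSection π l y)) (i k : W ⧸ pmW π l) : lamOf π l y i ≠ -lamOf π l y k := by
  intro h
  have h1 := (gaugeOfSection_eq_one_iff π l y (lamOf π l y i)).mpr ⟨i, rfl⟩
  rw [h, gaugeOfSection_neg_lamOf π l hR hl hp k] at h1
  exact absurd h1 (by decide)

/-- The gauge `p′` of `y′ = y·h` at `λ_i`: `p′(λ_i) = 1 ↔ h_i ∈ W_+` (reissue p. 22: «a gauge `p′` … `p′ = ±p`»).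
[cite: LanglandsShelstad1987, §2.5 (reissue p. 22)] -/
private theorem gauge_mulSec_lamOf {R : Finset X} (hR : IsStable Γ X R) (hl : l ∈ R) {y h : W ⧸ pmW π l → W}
    (hy : ∀ i, (y i : W ⧸ pmW π l) = i) (hh : ∀ k, h k ∈ pmW π l) (hp : IsGauge R (gaugeOfSection π l y))
    (i : W ⧸ pmW π l) : gaugeOfSection π l (fun k => y k * h k) (lamOf π l y i) = 1 ↔ h i ∈ plusW π l := by
  rw [gaugeOfSection_eq_one_iff]
  constructor
  · rintro ⟨k, hk⟩
    rw [lamOf_mulSec] at hk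
    by_cases hK : h k ∈ plusW π l
    · rw [(mem_plusW_iff π l _).mp hK, ← lamOf] at hk
      rw [lamOf_injective π l hy hk]; exact hK
    · rw [smul_eq_neg_of_mem_pmW π l (hh k) hK, smul_neg, ← lamOf] at hk
      exact absurd hk (lamOf_ne_neg_lamOf hR hl hp i k)
  · intro hi
    exact ⟨i, by rw [lamOf_mulSec, (mem_plusW_iff π l _).mp hi, lamOf]⟩

/-- The gauge `p′` of `y′ = y·h` at `−λ_i`: `p′(−λ_i) = 1 ↔ h_i ∉ W_+`. [cite: LanglandsShelstad1987, §2.5 (reissue p. 22)] -/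
private theorem gauge_mulSec_neg_lamOf {R : Finset X} (hR : IsStable Γ X R) (hl : l ∈ R) {y h : W ⧸ pmW π l → W}
    (hy : ∀ i, (y i : W ⧸ pmW π l) = i) (hh : ∀ k, h k ∈ pmW π l) (hp : IsGauge R (gaugeOfSection π l y))
    (i : W ⧸ pmW π l) : gaugeOfSection π l (fun k => y k * h k) (-lamOf π l y i) = 1 ↔ h i ∉ plusW π l := by
  rw [gaugeOfSection_eq_one_iff]
  constructor
  · rintro ⟨k, hk⟩
    rw [lamOf_mulSec] at hk
    by_cases hK : h k ∈ plusW π l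
    · rw [(mem_plusW_iff π l _).mp hK, ← lamOf] at hk
      exact absurd hk.symm (lamOf_ne_neg_lamOf hR hl hp k i)
    · rw [smul_eq_neg_of_mem_pmW π l (hh k) hK, smul_neg, ← lamOf, neg_inj] at hk
      rw [lamOf_injective π l hy hk]; exact hK
  · intro hi
    exact ⟨i, by rw [lamOf_mulSec, smul_eq_neg_of_mem_pmW π l (hh i) hi, smul_neg, lamOf]⟩

/-- A `ℤˣ`-valued gauge takes the value `−1` exactly where it is not `1`. [folklore] -/
private theorem units_ne_one_iff (a : ℤˣ) : a ≠ 1 ↔ a = -1 := by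
  rcases Int.units_eq_one_or a with rfl | rfl <;> decide

/-- **`Σ_i F_i = s_{p′/p}(π x)`** (reissue p. 22 with (2.4), p. 18): the `(−1)^{λ_i}`-terms of the section change that are indexed
by print's two filters of `s_{p′/p}` — `{p′ = 1, p′∘σ⁻¹ = −1, p = 1, p∘σ⁻¹ = 1}` (here: `h_i ∈ W_+`, `u_i ∈ W_+`, `h_j ∉ W_+`,
at `λ = λ_i`) and `{p′ = 1, p′∘σ⁻¹ = 1, p = −1, p∘σ⁻¹ = 1}` (here: `h_i ∉ W_+`, `u_i ∉ W_+`, `h_j ∈ W_+`, at `λ = −λ_i`).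
[cite: LanglandsShelstad1987, §2.4–2.5 (reissue pp. 18, 22)] -/
private theorem sum_F_eq_sCochain [Fintype (W ⧸ pmW π l)] [DecidablePred (· ∈ plusW π l)]
    (hπ : Function.Surjective π) {R : Finset X} (hR : IsStable Γ X R) (hS : IsSymm R) (hO : IsSigmaOrbitOf Γ R l)
    {y h : W ⧸ pmW π l → W} (hy : ∀ i, (y i : W ⧸ pmW π l) = i) (hh : ∀ k, h k ∈ pmW π l)
    (hp : IsGauge R (gaugeOfSection π l y)) (x : W) :
    ∑ i : W ⧸ pmW π l,
        ((if h i ∈ plusW π l ∧ uFun π l y i x ∈ plusW π l ∧ h (↑(x⁻¹ * y i)) ∉ plusW π l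
            then unitPow (-1 : ℂˣ) (lamOf π l y i) else 0) +
          (if h i ∉ plusW π l ∧ uFun π l y i x ∉ plusW π l ∧ h (↑(x⁻¹ * y i)) ∈ plusW π l
            then unitPow (-1 : ℂˣ) (lamOf π l y i) else 0)) =
      sCochain ℂ R (gaugeOfSection π l (fun k => y k * h k)) (gaugeOfSection π l y) (π x) := by
  classical
  have hl : l ∈ R := hO.1
  have h11 : (1 : ℤˣ) ≠ -1 := by decide
  have hj : ∀ i : W ⧸ pmW π l, (π x)⁻¹ • lamOf π l y i =
      π (y (↑(x⁻¹ * y i))) • (π (uFun π l y i x))⁻¹ • l := fun i => inv_smul_lamOf π l y i x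
  rw [Finset.sum_add_distrib, sCochain]
  congr 1
  · -- first filter, `λ = λ_i`
    rw [← Finset.sum_filter,
      ← Finset.sum_image (f := fun m => unitPow (-1 : ℂˣ) m) fun i _ k _ h => lamOf_injective π l hy h]
    refine Finset.sum_congr ?_ fun _ _ => rfl
    ext m
    simp only [Finset.mem_image, Finset.mem_filter, Finset.mem_univ, true_and]
    constructor
    · rintro ⟨i, ⟨hi1, hi2, hi3⟩, rfl⟩
      refine ⟨lamOf_mem π l hR hl y i, (gauge_mulSec_lamOf hR hl hy hh hp i).mpr hi1, ?_,
        (gaugeOfSection_eq_one_iff π l y _).mpr ⟨i, rfl⟩, ?_⟩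
      · rw [hj i, inv_smul_of_mem π l hi2, ← lamOf]
        exact (units_ne_one_iff _).mp fun h1 => hi3 ((gauge_mulSec_lamOf hR hl hy hh hp _).mp h1)
      · rw [hj i, inv_smul_of_mem π l hi2, ← lamOf]
        exact (gaugeOfSection_eq_one_iff π l y _).mpr ⟨_, rfl⟩
    · rintro ⟨hm, hq1, hq2, hp1, hp2⟩
      obtain ⟨i, rfl⟩ := (gaugeOfSection_eq_one_iff π l y m).mp hp1
      have hi1 : h i ∈ plusW π l := (gauge_mulSec_lamOf hR hl hy hh hp i).mp hq1
      have hi2 : uFun π l y i x ∈ plusW π l := by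
        by_contra hK
        rw [hj i, inv_smul_of_not_mem π l (uFun_mem π l hy i x) hK, smul_neg, ← lamOf,
          gaugeOfSection_neg_lamOf π l hR hl hp] at hp2
        exact h11 hp2.symm
      have hi3 : h (↑(x⁻¹ * y i)) ∉ plusW π l := by
        intro hK'
        rw [hj i, inv_smul_of_mem π l hi2, ← lamOf, (gauge_mulSec_lamOf hR hl hy hh hp _).mpr hK'] at hq2
        exact h11 hq2
      exact ⟨i, ⟨hi1, hi2, hi3⟩, rfl⟩
  · -- second filter, `λ = −λ_i`
    rw [← Finset.sum_filter]
    rw [Finset.sum_congr rfl fun i _ => (unitPow_negOne_neg ℂ (lamOf π l y i)).symm,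
      ← Finset.sum_image (f := fun m => unitPow (-1 : ℂˣ) m) (g := fun i => -lamOf π l y i)
        fun i _ k _ h => lamOf_injective π l hy (neg_inj.mp h)]
    refine Finset.sum_congr ?_ fun _ _ => rfl
    ext m
    simp only [Finset.mem_image, Finset.mem_filter, Finset.mem_univ, true_and]
    constructor
    · rintro ⟨i, ⟨hi1, hi2, hi3⟩, rfl⟩
      refine ⟨hS _ (lamOf_mem π l hR hl y i), (gauge_mulSec_neg_lamOf hR hl hy hh hp i).mpr hi1, ?_,
        gaugeOfSection_neg_lamOf π l hR hl hp i, ?_⟩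
      · rw [smul_neg, hj i, inv_smul_of_not_mem π l (uFun_mem π l hy i x) hi2, smul_neg, ← lamOf, neg_neg]
        exact (gauge_mulSec_lamOf hR hl hy hh hp _).mpr hi3
      · rw [smul_neg, hj i, inv_smul_of_not_mem π l (uFun_mem π l hy i x) hi2, smul_neg, ← lamOf, neg_neg]
        exact (gaugeOfSection_eq_one_iff π l y _).mpr ⟨_, rfl⟩
    · rintro ⟨hm, hq1, hq2, hp1, hp2⟩
      obtain ⟨i, hi | hi⟩ := exists_eq_lamOf_or_neg hπ hO hy hm
      · rw [hi, (gaugeOfSection_eq_one_iff π l y _).mpr ⟨i, rfl⟩] at hp1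
        exact absurd hp1 h11
      subst hi
      have hi1 : h i ∉ plusW π l := (gauge_mulSec_neg_lamOf hR hl hy hh hp i).mp hq1
      have hi2 : uFun π l y i x ∉ plusW π l := by
        intro hK
        rw [smul_neg, hj i, inv_smul_of_mem π l hK, ← lamOf, gaugeOfSection_neg_lamOf π l hR hl hp] at hp2
        exact h11 hp2.symm
      have hi3 : h (↑(x⁻¹ * y i)) ∈ plusW π l := by
        rw [smul_neg, hj i, inv_smul_of_not_mem π l (uFun_mem π l hy i x) hi2, smul_neg, ← lamOf, neg_neg] at hq2
        exact (gauge_mulSec_lamOf hR hl hy hh hp _).mp hq2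
      exact ⟨i, ⟨hi1, hi2, hi3⟩, rfl⟩

/-- **The `(−1)`-terms of the section change, χ-data** (`e = −1`): modulo `2·(−1)^{λ_i} = 0` the sign collection `X_i` of
`term_mulSec` equals `c_i^{λ_i} + F_i + c_j^{λ_i}`, where `c_k = ±1` according as `h_k ∈ W_+` or not and `F_i` are the two filter
indicators of `s_{p′/p}` (the parity bookkeeping behind reissue p. 22 «`s_{p′/p} r_p r′_{p′}⁻¹` is trivial»).
[cite: LanglandsShelstad1987, §2.5 (reissue p. 22)] -/
private theorem parity_chi [DecidablePred (· ∈ plusW π l)] (y h : W ⧸ pmW π l → W) (x : W) (i : W ⧸ pmW π l) :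
    ((if h i ∈ plusW π l ∧ uFun π l y i x ∉ plusW π l ∧ h (↑(x⁻¹ * y i)) ∉ plusW π l
          then unitPow (-1 : ℂˣ) (lamOf π l y i) else 0)
      - (if h i ∉ plusW π l ∧ uFun π l y i x ∈ plusW π l ∧ h (↑(x⁻¹ * y i)) ∈ plusW π l
          then unitPow (-1 : ℂˣ) (lamOf π l y i) else 0)
      - (if h i ∉ plusW π l ∧ uFun π l y i x ∈ plusW π l ∧ h (↑(x⁻¹ * y i)) ∉ plusW π l
          then unitPow (-1 : ℂˣ) (lamOf π l y i) + unitPow (-1 : ℂˣ) (lamOf π l y i) else 0)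
      - (if h i ∉ plusW π l ∧ uFun π l y i x ∉ plusW π l ∧ h (↑(x⁻¹ * y i)) ∈ plusW π l
          then unitPow (-1 : ℂˣ) (lamOf π l y i) + unitPow (-1 : ℂˣ) (lamOf π l y i) else 0)) =
      unitPow (if h i ∈ plusW π l then (1 : ℂˣ) else -1) (lamOf π l y i)
      + ((if h i ∈ plusW π l ∧ uFun π l y i x ∈ plusW π l ∧ h (↑(x⁻¹ * y i)) ∉ plusW π l
            then unitPow (-1 : ℂˣ) (lamOf π l y i) else 0)
        + (if h i ∉ plusW π l ∧ uFun π l y i x ∉ plusW π l ∧ h (↑(x⁻¹ * y i)) ∈ plusW π l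
            then unitPow (-1 : ℂˣ) (lamOf π l y i) else 0))
      + unitPow (if h (↑(x⁻¹ * y i)) ∈ plusW π l then (1 : ℂˣ) else -1) (lamOf π l y i) := by
  set a := h i with ha
  set b := h (↑(x⁻¹ * y i) : W ⧸ pmW π l) with hb
  set u := uFun π l y i x with hu
  have hνν : unitPow (-1 : ℂˣ) (lamOf π l y i) + unitPow (-1 : ℂˣ) (lamOf π l y i) = 0 :=
    unitPow_negOne_add_self ℂ (lamOf π l y i)
  have hνn : -unitPow (-1 : ℂˣ) (lamOf π l y i) = unitPow (-1 : ℂˣ) (lamOf π l y i) :=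
    neg_unitPow_neg_one (lamOf π l y i)
  by_cases hA : a ∈ plusW π l
  · by_cases hU : u ∈ plusW π l
    · by_cases hB : b ∈ plusW π l
      · rw [if_neg (show ¬(a ∈ plusW π l ∧ u ∉ plusW π l ∧ b ∉ plusW π l) from fun h => h.2.1 hU),
          if_neg (show ¬(a ∉ plusW π l ∧ u ∈ plusW π l ∧ b ∈ plusW π l) from fun h => h.1 hA),
          if_neg (show ¬(a ∉ plusW π l ∧ u ∈ plusW π l ∧ b ∉ plusW π l) from fun h => h.1 hA),
          if_neg (show ¬(a ∉ plusW π l ∧ u ∉ plusW π l ∧ b ∈ plusW π l) from fun h => h.1 hA),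
          if_neg (show ¬(a ∈ plusW π l ∧ u ∈ plusW π l ∧ b ∉ plusW π l) from fun h => h.2.2 hB),
          if_neg (show ¬(a ∉ plusW π l ∧ u ∉ plusW π l ∧ b ∈ plusW π l) from fun h => h.1 hA),
          if_pos (show a ∈ plusW π l from hA),
          if_pos (show b ∈ plusW π l from hB)]
        rw [unitPow_one]
        simp only [sub_zero, add_zero]
      · rw [if_neg (show ¬(a ∈ plusW π l ∧ u ∉ plusW π l ∧ b ∉ plusW π l) from fun h => h.2.1 hU),
          if_neg (show ¬(a ∉ plusW π l ∧ u ∈ plusW π l ∧ b ∈ plusW π l) from fun h => h.1 hA),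
          if_neg (show ¬(a ∉ plusW π l ∧ u ∈ plusW π l ∧ b ∉ plusW π l) from fun h => h.1 hA),
          if_neg (show ¬(a ∉ plusW π l ∧ u ∉ plusW π l ∧ b ∈ plusW π l) from fun h => h.1 hA),
          if_pos (show a ∈ plusW π l ∧ u ∈ plusW π l ∧ b ∉ plusW π l from ⟨hA, hU, hB⟩),
          if_neg (show ¬(a ∉ plusW π l ∧ u ∉ plusW π l ∧ b ∈ plusW π l) from fun h => h.1 hA),
          if_pos (show a ∈ plusW π l from hA),
          if_neg (show ¬(b ∈ plusW π l) from hB)]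
        rw [unitPow_one]
        simp only [sub_zero, add_zero, zero_add]
        exact hνν.symm
    · by_cases hB : b ∈ plusW π l
      · rw [if_neg (show ¬(a ∈ plusW π l ∧ u ∉ plusW π l ∧ b ∉ plusW π l) from fun h => h.2.2 hB),
          if_neg (show ¬(a ∉ plusW π l ∧ u ∈ plusW π l ∧ b ∈ plusW π l) from fun h => h.1 hA),
          if_neg (show ¬(a ∉ plusW π l ∧ u ∈ plusW π l ∧ b ∉ plusW π l) from fun h => h.1 hA),
          if_neg (show ¬(a ∉ plusW π l ∧ u ∉ plusW π l ∧ b ∈ plusW π l) from fun h => h.1 hA),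
          if_neg (show ¬(a ∈ plusW π l ∧ u ∈ plusW π l ∧ b ∉ plusW π l) from fun h => hU h.2.1),
          if_neg (show ¬(a ∉ plusW π l ∧ u ∉ plusW π l ∧ b ∈ plusW π l) from fun h => h.1 hA),
          if_pos (show a ∈ plusW π l from hA),
          if_pos (show b ∈ plusW π l from hB)]
        rw [unitPow_one]
        simp only [sub_zero, add_zero]
      · rw [if_pos (show a ∈ plusW π l ∧ u ∉ plusW π l ∧ b ∉ plusW π l from ⟨hA, hU, hB⟩),
          if_neg (show ¬(a ∉ plusW π l ∧ u ∈ plusW π l ∧ b ∈ plusW π l) from fun h => h.1 hA),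
          if_neg (show ¬(a ∉ plusW π l ∧ u ∈ plusW π l ∧ b ∉ plusW π l) from fun h => h.1 hA),
          if_neg (show ¬(a ∉ plusW π l ∧ u ∉ plusW π l ∧ b ∈ plusW π l) from fun h => h.1 hA),
          if_neg (show ¬(a ∈ plusW π l ∧ u ∈ plusW π l ∧ b ∉ plusW π l) from fun h => hU h.2.1),
          if_neg (show ¬(a ∉ plusW π l ∧ u ∉ plusW π l ∧ b ∈ plusW π l) from fun h => h.1 hA),
          if_pos (show a ∈ plusW π l from hA),
          if_neg (show ¬(b ∈ plusW π l) from hB)]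
        rw [unitPow_one]
        simp only [sub_zero, add_zero, zero_add]
  · by_cases hU : u ∈ plusW π l
    · by_cases hB : b ∈ plusW π l
      · rw [if_neg (show ¬(a ∈ plusW π l ∧ u ∉ plusW π l ∧ b ∉ plusW π l) from fun h => hA h.1),
          if_pos (show a ∉ plusW π l ∧ u ∈ plusW π l ∧ b ∈ plusW π l from ⟨hA, hU, hB⟩),
          if_neg (show ¬(a ∉ plusW π l ∧ u ∈ plusW π l ∧ b ∉ plusW π l) from fun h => h.2.2 hB),
          if_neg (show ¬(a ∉ plusW π l ∧ u ∉ plusW π l ∧ b ∈ plusW π l) from fun h => h.2.1 hU),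
          if_neg (show ¬(a ∈ plusW π l ∧ u ∈ plusW π l ∧ b ∉ plusW π l) from fun h => hA h.1),
          if_neg (show ¬(a ∉ plusW π l ∧ u ∉ plusW π l ∧ b ∈ plusW π l) from fun h => h.2.1 hU),
          if_neg (show ¬(a ∈ plusW π l) from hA),
          if_pos (show b ∈ plusW π l from hB)]
        rw [unitPow_one]
        simp only [sub_zero, add_zero, zero_sub]
        exact hνn
      · rw [if_neg (show ¬(a ∈ plusW π l ∧ u ∉ plusW π l ∧ b ∉ plusW π l) from fun h => hA h.1),
          if_neg (show ¬(a ∉ plusW π l ∧ u ∈ plusW π l ∧ b ∈ plusW π l) from fun h => hB h.2.2),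
          if_pos (show a ∉ plusW π l ∧ u ∈ plusW π l ∧ b ∉ plusW π l from ⟨hA, hU, hB⟩),
          if_neg (show ¬(a ∉ plusW π l ∧ u ∉ plusW π l ∧ b ∈ plusW π l) from fun h => h.2.1 hU),
          if_neg (show ¬(a ∈ plusW π l ∧ u ∈ plusW π l ∧ b ∉ plusW π l) from fun h => hA h.1),
          if_neg (show ¬(a ∉ plusW π l ∧ u ∉ plusW π l ∧ b ∈ plusW π l) from fun h => h.2.1 hU),
          if_neg (show ¬(a ∈ plusW π l) from hA),
          if_neg (show ¬(b ∈ plusW π l) from hB)]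
        rw [hνν]
        simp only [sub_zero, add_zero]
        exact hνν.symm
    · by_cases hB : b ∈ plusW π l
      · rw [if_neg (show ¬(a ∈ plusW π l ∧ u ∉ plusW π l ∧ b ∉ plusW π l) from fun h => hA h.1),
          if_neg (show ¬(a ∉ plusW π l ∧ u ∈ plusW π l ∧ b ∈ plusW π l) from fun h => hU h.2.1),
          if_neg (show ¬(a ∉ plusW π l ∧ u ∈ plusW π l ∧ b ∉ plusW π l) from fun h => hU h.2.1),
          if_pos (show a ∉ plusW π l ∧ u ∉ plusW π l ∧ b ∈ plusW π l from ⟨hA, hU, hB⟩),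
          if_neg (show ¬(a ∈ plusW π l ∧ u ∈ plusW π l ∧ b ∉ plusW π l) from fun h => hA h.1),
          if_pos (show a ∉ plusW π l ∧ u ∉ plusW π l ∧ b ∈ plusW π l from ⟨hA, hU, hB⟩),
          if_neg (show ¬(a ∈ plusW π l) from hA),
          if_pos (show b ∈ plusW π l from hB)]
        rw [hνν, unitPow_one]
        simp only [sub_zero, add_zero, zero_add]
        exact hνν.symm
      · rw [if_neg (show ¬(a ∈ plusW π l ∧ u ∉ plusW π l ∧ b ∉ plusW π l) from fun h => hA h.1),
          if_neg (show ¬(a ∉ plusW π l ∧ u ∈ plusW π l ∧ b ∈ plusW π l) from fun h => hU h.2.1),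
          if_neg (show ¬(a ∉ plusW π l ∧ u ∈ plusW π l ∧ b ∉ plusW π l) from fun h => hU h.2.1),
          if_neg (show ¬(a ∉ plusW π l ∧ u ∉ plusW π l ∧ b ∈ plusW π l) from fun h => hB h.2.2),
          if_neg (show ¬(a ∈ plusW π l ∧ u ∈ plusW π l ∧ b ∉ plusW π l) from fun h => hA h.1),
          if_neg (show ¬(a ∉ plusW π l ∧ u ∉ plusW π l ∧ b ∈ plusW π l) from fun h => hB h.2.2),
          if_neg (show ¬(a ∈ plusW π l) from hA),
          if_neg (show ¬(b ∈ plusW π l) from hB)]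
        simp only [sub_zero, add_zero]
        exact hνν.symm

/-- `c^{±λ_i} = c^{λ_i}` for a sign `c = ±1` (the exponent `π(y_i)π(u_i(x))λ = ±λ_i`). [folklore] -/
private theorem unitPow_sign_smul {y : W ⧸ pmW π l → W} (hy : ∀ i, (y i : W ⧸ pmW π l) = i) (P : Prop) [Decidable P]
    (x : W) (i : W ⧸ pmW π l) :
    unitPow (if P then (1 : ℂˣ) else -1) (π (y i) • π (uFun π l y i x) • l) =
      unitPow (if P then (1 : ℂˣ) else -1) (lamOf π l y i) := by
  by_cases hK : uFun π l y i x ∈ plusW π l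
  · rw [(mem_plusW_iff π l _).mp hK, lamOf]
  · rw [smul_eq_neg_of_mem_pmW π l (uFun_mem π l hy i x) hK, smul_neg, ← lamOf]
    by_cases hP : P
    · rw [if_pos hP, unitPow_one, unitPow_one]
    · rw [if_neg hP, unitPow_negOne_neg]

/-- **(S), ζ-data** (Corollary 2.5.B, reissue p. 22): for a change of section `y′ = y·h`, `c′ − c = ∂(Σ_i ζ-s(h_i)^{λ_i})` — the
term-by-term identity `term_mulSec` with `e = 1` (all sign terms vanish), summed and reindexed.
[cite: LanglandsShelstad1987, Corollary 2.5.B (reissue p. 22)] -/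
private theorem rCochain_mulSec_zeta [Finite Γ] (hπ : Function.Surjective π) {ζ : X → W → ℂˣ}
    {y h : W ⧸ pmW π l → W} {v₀ v₁ : W}
    (hmul : ∀ u ∈ plusW π l, ∀ u' ∈ plusW π l, ζ l (u * u') = ζ l u * ζ l u')
    (hinv : ∀ u ∈ plusW π l, ζ (-l) u = (ζ l u)⁻¹)
    (hconj : ∀ w : W, ∀ u ∈ plusW π l, ζ (π w • l) (w * u * w⁻¹) = ζ l u)
    (hsq : ∀ v ∈ pmW π l, v ∉ plusW π l → ζ l (v * v) = 1)
    (hv₀ : v₀ ∈ plusW π l) (hv₁ : stabPlus Γ X l ≠ stabPM Γ X l → v₁ ∈ pmW π l ∧ v₁ ∉ plusW π l)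
    (hy : ∀ i, (y i : W ⧸ pmW π l) = i) (hh : ∀ k, h k ∈ pmW π l) :
    ∃ m : UnitsTensor X ℂ, ∀ x : W,
      rCochain π l ζ (fun k => y k * h k) v₀ v₁ x - rCochain π l ζ y v₀ v₁ x = π x • m - m := by
  classical
  haveI := finite_quot hπ l
  haveI : Fintype (W ⧸ pmW π l) := Fintype.ofFinite _
  refine ⟨∑ i, unitPow (sFun π l ζ v₀ v₁ (h i)) (lamOf π l y i), fun x => ?_⟩
  have key : ∀ i : W ⧸ pmW π l,
      unitPow (sFun π l ζ v₀ v₁ (uFun π l (fun k => y k * h k) i x)) (lamOf π l (fun k => y k * h k) i) =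
        unitPow (sFun π l ζ v₀ v₁ (uFun π l y i x)) (lamOf π l y i)
        - unitPow (sFun π l ζ v₀ v₁ (h i)) (lamOf π l y i)
        + unitPow (sFun π l ζ v₀ v₁ (h (↑(x⁻¹ * y i)))) (π (y i) • π (uFun π l y i x) • l) := by
    intro i
    rw [term_mulSec hmul hinv hconj hsq inv_one hv₀ hv₁ hy hh x i]
    simp only [unitPow_one, add_zero, ite_self, sub_zero]
  simp only [rCochain, finsum_eq_sum_of_fintype]
  rw [Finset.sum_congr rfl fun i _ => key i,
    smul_sum_unitPow_lamOf hy (fun k => sFun π l ζ v₀ v₁ (h k)) x, Finset.sum_add_distrib, Finset.sum_sub_distrib]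
  abel

/-- `(−1)⁻¹ = −1` in `ℂ^×`. [folklore] -/
private theorem inv_neg_one_units : (-1 : ℂˣ)⁻¹ = -1 := by
  rw [inv_eq_iff_mul_eq_one, neg_mul_neg, one_mul]

/-- **(S), χ-data** (reissue p. 22, «Another choice `w′_1, …, w′_n` … leads to a gauge `p′` and it has to be shown that the cocycle
`s_{p′/p} r_p r′_{p′}⁻¹` is trivial»): for `y′ = y·h`,
`r′_{p′} − r_p − s_{p′/p}∘π = ∂(Σ_i s(h_i)^{λ_i} + Σ_i c_i^{λ_i})`, `c_i = ±1` as `h_i ∈ W_+` or not — `term_mulSec` with `e = −1`,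
`parity_chi`, `sum_F_eq_sCochain`, summed and reindexed. [cite: LanglandsShelstad1987, §2.5 (reissue p. 22)] -/
private theorem rCochain_mulSec_chi [Finite Γ] (hπ : Function.Surjective π) {R : Finset X} {χ : X → W → ℂˣ}
    {y h : W ⧸ pmW π l → W} {v₀ v₁ : W}
    (hR : IsStable Γ X R) (hS : IsSymm R) (hO : IsSigmaOrbitOf Γ R l)
    (hmul : ∀ u ∈ plusW π l, ∀ u' ∈ plusW π l, χ l (u * u') = χ l u * χ l u')
    (hinv : ∀ u ∈ plusW π l, χ (-l) u = (χ l u)⁻¹)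
    (hconj : ∀ w : W, ∀ u ∈ plusW π l, χ (π w • l) (w * u * w⁻¹) = χ l u)
    (hsq : ∀ v ∈ pmW π l, v ∉ plusW π l → χ l (v * v) = -1)
    (hv₀ : v₀ ∈ plusW π l) (hv₁ : stabPlus Γ X l ≠ stabPM Γ X l → v₁ ∈ pmW π l ∧ v₁ ∉ plusW π l)
    (hy : ∀ i, (y i : W ⧸ pmW π l) = i) (hh : ∀ k, h k ∈ pmW π l) (hp : IsGauge R (gaugeOfSection π l y)) :
    ∃ m : UnitsTensor X ℂ, ∀ x : W,
      rCochain π l χ (fun k => y k * h k) v₀ v₁ x - rCochain π l χ y v₀ v₁ x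
        - sCochain ℂ R (gaugeOfSection π l (fun k => y k * h k)) (gaugeOfSection π l y) (π x) = π x • m - m := by
  classical
  haveI := finite_quot hπ l
  haveI : Fintype (W ⧸ pmW π l) := Fintype.ofFinite _
  set M : UnitsTensor X ℂ := ∑ i, unitPow (sFun π l χ v₀ v₁ (h i)) (lamOf π l y i) with hM
  set N : UnitsTensor X ℂ := ∑ i, unitPow (if h i ∈ plusW π l then (1 : ℂˣ) else -1) (lamOf π l y i) with hN
  have hNN : N + N = 0 := by
    rw [hN, ← Finset.sum_add_distrib]
    refine Finset.sum_eq_zero fun i _ => ?_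
    rw [← unitPow_mul]
    by_cases hK : h i ∈ plusW π l
    · rw [if_pos hK, mul_one, unitPow_one]
    · rw [if_neg hK, neg_mul_neg, mul_one, unitPow_one]
  have hNn : -N = N := by rw [neg_eq_iff_add_eq_zero, hNN]
  refine ⟨M + N, fun x => ?_⟩
  have key : ∀ i : W ⧸ pmW π l,
      unitPow (sFun π l χ v₀ v₁ (uFun π l (fun k => y k * h k) i x)) (lamOf π l (fun k => y k * h k) i) =
        unitPow (sFun π l χ v₀ v₁ (uFun π l y i x)) (lamOf π l y i)
        - unitPow (sFun π l χ v₀ v₁ (h i)) (lamOf π l y i)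
        + unitPow (sFun π l χ v₀ v₁ (h (↑(x⁻¹ * y i)))) (π (y i) • π (uFun π l y i x) • l)
        + (unitPow (if h i ∈ plusW π l then (1 : ℂˣ) else -1) (lamOf π l y i)
          + ((if h i ∈ plusW π l ∧ uFun π l y i x ∈ plusW π l ∧ h (↑(x⁻¹ * y i)) ∉ plusW π l
                then unitPow (-1 : ℂˣ) (lamOf π l y i) else 0)
            + (if h i ∉ plusW π l ∧ uFun π l y i x ∉ plusW π l ∧ h (↑(x⁻¹ * y i)) ∈ plusW π l
                then unitPow (-1 : ℂˣ) (lamOf π l y i) else 0))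
          + unitPow (if h (↑(x⁻¹ * y i)) ∈ plusW π l then (1 : ℂˣ) else -1)
              (π (y i) • π (uFun π l y i x) • l)) := by
    intro i
    rw [term_mulSec hmul hinv hconj hsq inv_neg_one_units hv₀ hv₁ hy hh x i, parity_chi y h x i,
      unitPow_sign_smul hy (h (↑(x⁻¹ * y i)) ∈ plusW π l) x i]
  have hsum : rCochain π l χ (fun k => y k * h k) v₀ v₁ x - rCochain π l χ y v₀ v₁ x
      - sCochain ℂ R (gaugeOfSection π l (fun k => y k * h k)) (gaugeOfSection π l y) (π x) =
      (π x • M - M) + (N + π x • N) := by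
    rw [← sum_F_eq_sCochain hπ hR hS hO hy hh hp x, hM, hN, smul_sum_unitPow_lamOf hy (fun k => sFun π l χ v₀ v₁ (h k)) x,
      smul_sum_unitPow_lamOf hy (fun k => if h k ∈ plusW π l then (1 : ℂˣ) else -1) x]
    simp only [rCochain, finsum_eq_sum_of_fintype]
    rw [Finset.sum_congr rfl fun i _ => key i]
    simp only [Finset.sum_add_distrib, Finset.sum_sub_distrib]
    abel
  rw [hsum, smul_add, show N + π x • N = π x • N + -N by rw [hNn, add_comm]]
  abel

/-! ### (T) change of the base point `λ ↦ λ′ = ±κλ` (reissue p. 22, last paragraph): conjugation transport -/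

/-- `W_{±λ′} = v W_{±λ} v⁻¹` for `λ′ = ±π(v)λ` (reissue p. 22: «`Γ_{+λ′} = κΓ_{+λ}κ⁻¹`»), membership form.
[cite: LanglandsShelstad1987, §2.5 (reissue p. 22)] -/
private theorem mem_pmW_transport {l l' : X} (g : W) (hg : l' = π g • l ∨ l' = -(π g • l)) (w : W) :
    w ∈ pmW π l' ↔ g⁻¹ * w * g ∈ pmW π l := by
  rw [mem_pmW_iff, mem_pmW_iff, map_mul, map_mul, map_inv, mul_smul, mul_smul, inv_smul_eq_iff, inv_smul_eq_iff,
    smul_neg]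
  rcases hg with rfl | rfl
  · exact Iff.rfl
  · rw [smul_neg, neg_inj, neg_inj]

/-- `W_{+λ′} = v W_{+λ} v⁻¹` for `λ′ = ±π(v)λ`, membership form. [cite: LanglandsShelstad1987, §2.5 (reissue p. 22)] -/
private theorem mem_plusW_transport {l l' : X} (g : W) (hg : l' = π g • l ∨ l' = -(π g • l)) (w : W) :
    w ∈ plusW π l' ↔ g⁻¹ * w * g ∈ plusW π l := by
  rw [mem_plusW_iff, mem_plusW_iff, map_mul, map_mul, map_inv, mul_smul, mul_smul, inv_smul_eq_iff]
  rcases hg with rfl | rfl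
  · exact Iff.rfl
  · rw [smul_neg, neg_inj]

/-- Two `ℤˣ`-valued functions agree where they take the value `1` simultaneously. [folklore] -/
private theorem units_eq_of_iff {a b : ℤˣ} (h : a = 1 ↔ b = 1) : a = b := by
  rcases Int.units_eq_one_or a with ha | ha <;> rcases Int.units_eq_one_or b with hb | hb
  · rw [ha, hb]
  · exact absurd (h.mp ha) (by rw [hb]; decide)
  · exact absurd (h.mpr hb) (by rw [ha]; decide)
  · rw [ha, hb]

/-- **(T) Transport of the construction along `λ ↦ λ′ = ±κλ`** (reissue p. 22: «Finally, replacing `λ` by `−λ` clearly has no effect.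
If we replace `λ` by `λ′ = κλ` and `v ∈ W` is a lifting of `κ` then `Γ_{+λ′} = κΓ_{+λ}κ⁻¹` and we may take `σ′_i = κσ_i`. Then
`λ′_i = λ_i` and we set `w′_i = v w_i`, so that `u′_i(w) = v u_i(w) v⁻¹`. We also take `v′_0 = v v_0 v⁻¹` … Since
`χ_{λ′}(vxv⁻¹) = χ_λ(x)` the independence is clear»), read backwards: the data `(y′, v′_0, v′_1)` at `λ′ = ±π(v)λ` are the
`v`-conjugates of data `(ỹ, ṽ_0, ṽ_1)` at `λ` (`ỹ(x W_{±λ}) = y′(x v⁻¹ W_{±λ′}) v`, `ṽ = v⁻¹ v′ v`) with THE SAME cochain `r`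
(resp. `c`), and with gauge `p̃ = p′` resp. `p̃ = p′∘(−1)` in the case `λ′ = −π(v)λ`.  Uses (i), both halves of (ii); serves
χ- and ζ-data. [cite: LanglandsShelstad1987, §2.5 (reissue p. 22)] -/
private theorem transport [Finite Γ] (hπ : Function.Surjective π) {R : Finset X} {ζ : X → W → ℂˣ} (hR : IsStable Γ X R)
    {l l' : X} (hl : l ∈ R) (g : W) (hg : l' = π g • l ∨ l' = -(π g • l))
    (hζ : ∀ m ∈ R,
      (∀ u ∈ plusW π m, ∀ u' ∈ plusW π m, ζ m (u * u') = ζ m u * ζ m u') ∧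
      (∀ u ∈ plusW π m, ζ (-m) u = (ζ m u)⁻¹) ∧
      (∀ w : W, ∀ u ∈ plusW π m, ζ (π w • m) (w * u * w⁻¹) = ζ m u))
    {y' : W ⧸ pmW π l' → W} {v₀' v₁' : W} (hy' : ∀ i, (y' i : W ⧸ pmW π l') = i) (hv₀' : v₀' ∈ plusW π l')
    (hv₁' : stabPlus Γ X l' ≠ stabPM Γ X l' → v₁' ∈ pmW π l' ∧ v₁' ∉ plusW π l') :
    ∃ yt : W ⧸ pmW π l → W, (∀ i, (yt i : W ⧸ pmW π l) = i) ∧ g⁻¹ * v₀' * g ∈ plusW π l ∧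
      (stabPlus Γ X l ≠ stabPM Γ X l → g⁻¹ * v₁' * g ∈ pmW π l ∧ g⁻¹ * v₁' * g ∉ plusW π l) ∧
      (∀ x : W, rCochain π l' ζ y' v₀' v₁' x = rCochain π l ζ yt (g⁻¹ * v₀' * g) (g⁻¹ * v₁' * g) x) ∧
      ((∀ m : X, gaugeOfSection π l yt m = gaugeOfSection π l' y' m) ∨
        (∀ m : X, gaugeOfSection π l yt m = gaugeOfSection π l' y' (-m))) := by
  classical
  haveI := finite_quot hπ l
  haveI := finite_quot hπ l'
  haveI : Fintype (W ⧸ pmW π l) := Fintype.ofFinite _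
  haveI : Fintype (W ⧸ pmW π l') := Fintype.ofFinite _
  -- `σ•λ ∈ R`, the clauses of the data at `σ•λ` and at `λ′`
  have hσl : π g • l ∈ R := hR _ _ hl
  obtain ⟨-, hinvσ, hconjσ⟩ := hζ _ hσl
  -- `W_{+λ′} = W_{+σλ}` (also when `λ′ = −σλ`)
  have hplus' : ∀ u : W, u ∈ plusW π l' ↔ u ∈ plusW π (π g • l) := by
    intro u
    rw [mem_plusW_transport g hg, mem_plusW_transport g (Or.inl rfl)]
  -- the reindexing `Φ : W/W_{±λ′} ≃ W/W_{±λ}`, `x W_{±λ′} ↦ x v W_{±λ}`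
  let Φ : W ⧸ pmW π l' ≃ W ⧸ pmW π l :=
    Quotient.congr (Equiv.mulRight g) fun a b => by
      rw [QuotientGroup.leftRel_apply, QuotientGroup.leftRel_apply, mem_pmW_transport g hg]
      have : g⁻¹ * (a⁻¹ * b) * g = (a * g)⁻¹ * (b * g) := by group
      rw [this]
      exact Iff.rfl
  have hΦ : ∀ a : W, Φ (a : W ⧸ pmW π l') = ((a * g : W) : W ⧸ pmW π l) := fun a => rfl
  -- the transported section
  let yt : W ⧸ pmW π l → W := fun i => y' (Φ.symm i) * g
  have hyt : ∀ i, (yt i : W ⧸ pmW π l) = i := by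
    intro i
    show ((y' (Φ.symm i) * g : W) : W ⧸ pmW π l) = i
    rw [← hΦ, hy', Equiv.apply_symm_apply]
  have hyt_apply : ∀ i' : W ⧸ pmW π l', yt (Φ i') = y' i' * g := by
    intro i'; show y' (Φ.symm (Φ i')) * g = y' i' * g; rw [Equiv.symm_apply_apply]
  -- `u_i` transports by conjugation
  have huFun : ∀ (i' : W ⧸ pmW π l') (x : W), uFun π l yt (Φ i') x = g⁻¹ * uFun π l' y' i' x * g := by
    intro i' x
    have hidx : (↑(x⁻¹ * yt (Φ i')) : W ⧸ pmW π l) = Φ (↑(x⁻¹ * y' i')) := by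
      rw [hyt_apply, hΦ, mul_assoc]
    simp only [uFun]
    rw [hidx, hyt_apply, hyt_apply]
    group
  -- `λ_i` transports
  have hlamOf : ∀ i' : W ⧸ pmW π l', lamOf π l yt (Φ i') = π (y' i') • π g • l := by
    intro i'; rw [lamOf, hyt_apply, map_mul, mul_smul]
  -- `v_0`, `v_1`
  have hv₀t : g⁻¹ * v₀' * g ∈ plusW π l := (mem_plusW_transport g hg v₀').mp hv₀'
  have hstab : stabPlus Γ X l ≠ stabPM Γ X l → stabPlus Γ X l' ≠ stabPM Γ X l' := by
    intro hne heq
    apply hne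
    apply Subgroup.comap_injective hπ
    show plusW π l = pmW π l
    ext w
    have h1 := mem_plusW_transport g hg (g * w * g⁻¹)
    have h2 := mem_pmW_transport g hg (g * w * g⁻¹)
    have e : g⁻¹ * (g * w * g⁻¹) * g = w := by group
    rw [e] at h1 h2
    rw [← h1, ← h2]
    show g * w * g⁻¹ ∈ (stabPlus Γ X l').comap π ↔ g * w * g⁻¹ ∈ (stabPM Γ X l').comap π
    rw [heq]
  have hv₁t : stabPlus Γ X l ≠ stabPM Γ X l → g⁻¹ * v₁' * g ∈ pmW π l ∧ g⁻¹ * v₁' * g ∉ plusW π l := by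
    intro hne
    obtain ⟨h1, h2⟩ := hv₁' (hstab hne)
    exact ⟨(mem_pmW_transport g hg v₁').mp h1, fun h => h2 ((mem_plusW_transport g hg v₁').mpr h)⟩
  -- `v_0(u)` transports
  have hv0Fun : ∀ u : W, v0Fun π l (g⁻¹ * v₀' * g) (g⁻¹ * v₁' * g) (g⁻¹ * u * g) =
      g⁻¹ * v0Fun π l' v₀' v₁' u * g := by
    intro u
    by_cases hu : u ∈ plusW π l'
    · rw [v0Fun_of_mem hu, v0Fun_of_mem ((mem_plusW_transport g hg u).mp hu)]; group
    · rw [v0Fun_of_not_mem hu, v0Fun_of_not_mem (fun h => hu ((mem_plusW_transport g hg u).mpr h))]; group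
  -- `v_0(u) ∈ W_{+λ′}` for `u ∈ W_{±λ′}`
  have hv0mem : ∀ u ∈ pmW π l', v0Fun π l' v₀' v₁' u ∈ plusW π l' := by
    intro u hu
    by_cases hun : u ∈ plusW π l'
    · rw [v0Fun_of_mem hun]
      exact conj_mem_plusW π l' (plusW_le_pmW π l' hv₀') hun
    · obtain ⟨h1, h2⟩ := hv₁' (stab_ne_of_not_mem hu hun)
      rw [v0Fun_of_not_mem hun]
      exact mul_mem_plusW_of_not_mem π l' (mul_mem (plusW_le_pmW π l' hv₀') hu)
        (mul_not_mem_plusW_left π l' hv₀' hun) (inv_mem h1) (fun h => h2 ((Subgroup.inv_mem_iff _).mp h))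
  -- `χ_λ(v⁻¹ z v) = χ_{σλ}(z)` for `z ∈ W_{+σλ}`
  have hchi : ∀ z ∈ plusW π l', ζ l (g⁻¹ * z * g) = ζ (π g • l) z := by
    intro z hz
    have h := hconjσ g⁻¹ z ((hplus' z).mp hz)
    rwa [map_inv, inv_smul_smul, inv_inv] at h
  -- the term-by-term equality
  have hterm : ∀ (i' : W ⧸ pmW π l') (x : W),
      unitPow (sFun π l' ζ v₀' v₁' (uFun π l' y' i' x)) (lamOf π l' y' i') =
        unitPow (sFun π l ζ (g⁻¹ * v₀' * g) (g⁻¹ * v₁' * g) (uFun π l yt (Φ i') x)) (lamOf π l yt (Φ i')) := by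
    intro i' x
    rw [huFun, hlamOf, sFun, sFun, hv0Fun, hchi _ (hv0mem _ (uFun_mem π l' hy' i' x))]
    rcases hg with rfl | rfl
    · rfl
    · rw [lamOf, smul_neg, hinvσ _ ((hplus' _).mp (hv0mem _ (uFun_mem π _ hy' i' x))), unitPow_inv_neg]
  refine ⟨yt, hyt, hv₀t, hv₁t, fun x => ?_, ?_⟩
  · simp only [rCochain, finsum_eq_sum_of_fintype]
    exact Fintype.sum_equiv Φ _ _ fun i' => hterm i' x
  · have hex : ∀ m : X, (∃ i, m = lamOf π l yt i) ↔ ∃ i', m = π (y' i') • π g • l := by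
      intro m
      constructor
      · rintro ⟨i, hi⟩
        refine ⟨Φ.symm i, ?_⟩
        rw [hi, ← hlamOf, Equiv.apply_symm_apply]
      · rintro ⟨i', hi⟩
        exact ⟨Φ i', by rw [hi, hlamOf]⟩
    rcases hg with rfl | rfl
    · left
      intro m
      apply units_eq_of_iff
      rw [gaugeOfSection_eq_one_iff, gaugeOfSection_eq_one_iff, hex]
      simp only [lamOf]
    · right
      intro m
      apply units_eq_of_iff
      rw [gaugeOfSection_eq_one_iff, gaugeOfSection_eq_one_iff, hex]
      simp only [lamOf, smul_neg, neg_inj]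

/-! ### Gluing (reissue p. 22 with Corollary 2.4.B (ii) and «`s_{p/−p} = 1`», p. 18) -/

/-- `s_{q/p}` only reads the gauges on `R` (for `Γ`-stable `R`): congruence in the second gauge. [cite: LanglandsShelstad1987, §2.4 (reissue p. 18)] -/
private theorem sCochain_congr_right {R : Finset X} (hR : IsStable Γ X R) (q : X → ℤˣ) {p₁ p₂ : X → ℤˣ}
    (h : ∀ m ∈ R, p₁ m = p₂ m) (σ : Γ) : sCochain ℂ R q p₁ σ = sCochain ℂ R q p₂ σ := by
  classical
  simp only [sCochain]
  congr 1
  · exact Finset.sum_congr (Finset.filter_congr fun m hm => by rw [h m hm, h _ (hR _ _ hm)]) fun _ _ => rfl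
  · exact Finset.sum_congr (Finset.filter_congr fun m hm => by rw [h m hm, h _ (hR _ _ hm)]) fun _ _ => rfl

/-- `−p` is a gauge when `p` is. [cite: LanglandsShelstad1987, §2.1 (reissue p. 11)] -/
private theorem isGauge_neg {R : Finset X} {p : X → ℤˣ} (hp : IsGauge R p) : IsGauge R (-p) := by
  intro m hm
  simp only [Pi.neg_apply, hp m hm, neg_neg]

/-- The section `y′` of the same quotient differs from `y` by `h_i = y_i⁻¹ y′_i ∈ W_±`. [cite: LanglandsShelstad1987, §2.5 (reissue p. 22)] -/
private theorem section_eq_mulSec {y y' : W ⧸ pmW π l → W} (hy : ∀ i, (y i : W ⧸ pmW π l) = i)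
    (hy' : ∀ i, (y' i : W ⧸ pmW π l) = i) :
    (∀ k, (y k)⁻¹ * y' k ∈ pmW π l) ∧ y' = fun k => y k * ((y k)⁻¹ * y' k) := by
  refine ⟨fun k => QuotientGroup.eq.mp ((hy k).trans (hy' k).symm), funext fun k => ?_⟩
  rw [mul_inv_cancel_left]

/-- Discharge of `Corollary_2_5_B_indep` [cite: LanglandsShelstad1987, Corollary 2.5.B (reissue p. 22)]: «Its cohomology class is
independent of the choices made in its construction.»  Printed argument (p. 22, for `r_p`, read with `ζ` for `χ`): transport along
`λ ↦ λ′` (`transport`), change of section (`rCochain_mulSec_zeta`), change of `v_0, v_1` (`rCochain_vChange`), each an explicit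
1-coboundary. -/
theorem Corollary_2_5_B_indep_holds : Corollary_2_5_B_indep := by
  intro Γ _ _ X _ _ _ _ W _ π hπ R l l' ζ y y' v₀ v₁ v₀' v₁' hR hS hO hO' hζ hc hc' hp hp'
  classical
  obtain ⟨hy, hv₀, hv₁⟩ := hc
  obtain ⟨hy', hv₀', hv₁'⟩ := hc'
  have hζ3 : ∀ m ∈ R,
      (∀ u ∈ plusW π m, ∀ u' ∈ plusW π m, ζ m (u * u') = ζ m u * ζ m u') ∧
      (∀ u ∈ plusW π m, ζ (-m) u = (ζ m u)⁻¹) ∧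
      (∀ w : W, ∀ u ∈ plusW π m, ζ (π w • m) (w * u * w⁻¹) = ζ m u) :=
    fun m hm => ⟨(hζ m hm).1, (hζ m hm).2.1, (hζ m hm).2.2.1⟩
  obtain ⟨hmul, hinv, hconj, hsq⟩ := hζ l hO.1
  -- `λ′ = ±σλ`, `σ = π g`
  obtain ⟨g, hg⟩ : ∃ g : W, l' = π g • l ∨ l' = -(π g • l) := by
    rcases (hO.2 l').mp hO'.1 with ⟨σ, hσ⟩ | ⟨σ, hσ⟩
    · obtain ⟨g, rfl⟩ := hπ σ; exact ⟨g, Or.inl hσ⟩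
    · obtain ⟨g, rfl⟩ := hπ σ; exact ⟨g, Or.inr hσ⟩
  -- (T)
  obtain ⟨yt, hyt, hv₀t, hv₁t, hr, -⟩ := transport hπ hR hO.1 g hg hζ3 hy' hv₀' hv₁'
  -- (S)
  obtain ⟨hh, hyth⟩ := section_eq_mulSec hy hyt
  obtain ⟨m₁, hm₁⟩ := rCochain_mulSec_zeta hπ hmul hinv hconj hsq hv₀t hv₁t hy hh
  -- (V)
  obtain ⟨m₂, hm₂⟩ := rCochain_vChange hπ hmul hconj hy hv₀ hv₁ hv₀t hv₁t
  refine ⟨-(m₁ + m₂), fun w => ?_⟩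
  simp only [cCochain]
  rw [hr w, hyth]
  have e1 := hm₁ w
  have e2 := hm₂ w
  rw [smul_neg, smul_add]
  -- `r − r̃′ = −(r̃′ − r_ṽ) − (r_ṽ − r)`
  calc rCochain π l ζ y v₀ v₁ w - rCochain π l ζ (fun k => y k * ((y k)⁻¹ * yt k)) (g⁻¹ * v₀' * g) (g⁻¹ * v₁' * g) w
      = -(rCochain π l ζ (fun k => y k * ((y k)⁻¹ * yt k)) (g⁻¹ * v₀' * g) (g⁻¹ * v₁' * g) w -
            rCochain π l ζ y (g⁻¹ * v₀' * g) (g⁻¹ * v₁' * g) w) -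
          (rCochain π l ζ y (g⁻¹ * v₀' * g) (g⁻¹ * v₁' * g) w - rCochain π l ζ y v₀ v₁ w) := by abel
    _ = -(π w • m₁ - m₁) - (π w • m₂ - m₂) := by rw [e1, e2]
    _ = -(π w • m₁ + π w • m₂) - -(m₁ + m₂) := by abel

/-- Discharge of `Remark_2_5_indep` [cite: LanglandsShelstad1987, §2.5 (reissue p. 22)]: «the various choices made have no effect on
`r_q`, up to 1-coboundaries.»  Printed argument followed with its two Shapiro reductions unwound (see the header of this section):
(T) `transport` along `λ ↦ λ′ = ±κλ` — an equality `r′ = r̃` with gauge `p̃ = p′` or `p′∘(−1)`; (S) `rCochain_mulSec_chi`: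
`r̃_{p̃} − r_{p} − s_{p̃/p}∘π` is a coboundary («`s_{p′/p} r_p r′_{p′}⁻¹` is trivial»); (V) `rCochain_vChange`; and for the
gauges `s_{q/p} − s_{q/p̃} − s_{p̃/p}` resp. (when `p′ = −p̃` on `R`) `s_{q/p} − s_{q/−p̃} − s_{p̃/p}` is a coboundary by ★
`Corollary_2_4_B_ii_holds` and ★ `Remark_2_4_trivial_holds` (`s_{p̃/−p̃} = 1`). -/
theorem Remark_2_5_indep_holds : Remark_2_5_indep := by
  intro Γ _ _ X _ _ _ _ W _ π hπ R l l' χ y y' v₀ v₁ v₀' v₁' q hR hS hO hO' hχ hc hc' hp hp' hq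
  classical
  obtain ⟨hy, hv₀, hv₁⟩ := hc
  obtain ⟨hy', hv₀', hv₁'⟩ := hc'
  have hχ3 : ∀ m ∈ R,
      (∀ u ∈ plusW π m, ∀ u' ∈ plusW π m, χ m (u * u') = χ m u * χ m u') ∧
      (∀ u ∈ plusW π m, χ (-m) u = (χ m u)⁻¹) ∧
      (∀ w : W, ∀ u ∈ plusW π m, χ (π w • m) (w * u * w⁻¹) = χ m u) :=
    fun m hm => ⟨(hχ m hm).1, (hχ m hm).2.1, (hχ m hm).2.2.1⟩
  obtain ⟨hmul, hinv, hconj, hsq⟩ := hχ l hO.1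
  -- `λ′ = ±σλ`, `σ = π g`
  obtain ⟨g, hg⟩ : ∃ g : W, l' = π g • l ∨ l' = -(π g • l) := by
    rcases (hO.2 l').mp hO'.1 with ⟨σ, hσ⟩ | ⟨σ, hσ⟩
    · obtain ⟨g, rfl⟩ := hπ σ; exact ⟨g, Or.inl hσ⟩
    · obtain ⟨g, rfl⟩ := hπ σ; exact ⟨g, Or.inr hσ⟩
  -- (T)
  obtain ⟨yt, hyt, hv₀t, hv₁t, hr, hgauge⟩ := transport hπ hR hO.1 g hg hχ3 hy' hv₀' hv₁'
  -- the transported gauge `p̃` is a gauge on `R`, and `p′ = p̃` or `p′ = −p̃` on `R`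
  have hpt : IsGauge R (gaugeOfSection π l yt) := by
    rcases hgauge with h | h
    · intro m hm; rw [h, h, hp' m hm]
    · intro m hm; rw [h, h, neg_neg, hp' m hm, neg_neg]
  -- (S) with the transported `v`'s, (V)
  obtain ⟨hh, hyth⟩ := section_eq_mulSec hy hyt
  obtain ⟨m₁, hm₁⟩ := rCochain_mulSec_chi hπ hR hS hO hmul hinv hconj hsq hv₀t hv₁t hy hh hp
  obtain ⟨m₂, hm₂⟩ := rCochain_vChange hπ hmul hconj hy hv₀ hv₁ hv₀t hv₁t
  rw [← hyth] at hm₁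
  -- the gauge terms: `s_{q/p}(σ) − s_{q/p′}(σ) − s_{p̃/p}(σ) = σ•z − z`
  obtain ⟨z, hz⟩ : ∃ z : UnitsTensor X ℂ, ∀ σ : Γ,
      sCochain ℂ R q (gaugeOfSection π l y) σ - sCochain ℂ R q (gaugeOfSection π l' y') σ -
        sCochain ℂ R (gaugeOfSection π l yt) (gaugeOfSection π l y) σ = σ • z - z := by
    obtain ⟨z₁, hz₁⟩ := Corollary_2_4_B_ii_holds ℂ R q (gaugeOfSection π l yt) (gaugeOfSection π l y) hR hS hq hpt hp
    rcases hgauge with h | h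
    · have hpp : gaugeOfSection π l yt = gaugeOfSection π l' y' := funext h
      refine ⟨-z₁, fun σ => ?_⟩
      have e1 := hz₁ σ
      dsimp only at e1
      rw [← hpp, smul_neg]
      calc sCochain ℂ R q (gaugeOfSection π l y) σ - sCochain ℂ R q (gaugeOfSection π l yt) σ -
            sCochain ℂ R (gaugeOfSection π l yt) (gaugeOfSection π l y) σ
          = -(sCochain ℂ R q (gaugeOfSection π l yt) σ + sCochain ℂ R (gaugeOfSection π l yt) (gaugeOfSection π l y) σ -
              sCochain ℂ R q (gaugeOfSection π l y) σ) := by abel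
        _ = -(σ • z₁ - z₁) := by rw [← e1]
        _ = -(σ • z₁) - -z₁ := by abel
    · -- `p′ = −p̃` on `R`
      have hpp : ∀ m ∈ R, gaugeOfSection π l' y' m = (-gaugeOfSection π l yt) m := by
        intro m hm
        rw [Pi.neg_apply, h, hp' m hm, neg_neg]
      obtain ⟨z₂, hz₂⟩ := Corollary_2_4_B_ii_holds ℂ R q (gaugeOfSection π l yt) (-gaugeOfSection π l yt) hR hS hq hpt
        (isGauge_neg hpt)
      have h0 : ∀ σ : Γ, sCochain ℂ R (gaugeOfSection π l yt) (-gaugeOfSection π l yt) σ = 0 := fun σ =>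
        (Remark_2_4_trivial_holds ℂ R (gaugeOfSection π l yt) hR hS hpt σ).2.2
      refine ⟨z₂ - z₁, fun σ => ?_⟩
      rw [sCochain_congr_right hR q hpp σ]
      have e1 := hz₁ σ
      have e2 := hz₂ σ
      dsimp only at e1 e2
      rw [h0, add_zero] at e2
      rw [smul_sub]
      calc sCochain ℂ R q (gaugeOfSection π l y) σ - sCochain ℂ R q (-gaugeOfSection π l yt) σ -
            sCochain ℂ R (gaugeOfSection π l yt) (gaugeOfSection π l y) σ
          = (sCochain ℂ R q (gaugeOfSection π l yt) σ - sCochain ℂ R q (-gaugeOfSection π l yt) σ) -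
            (sCochain ℂ R q (gaugeOfSection π l yt) σ + sCochain ℂ R (gaugeOfSection π l yt) (gaugeOfSection π l y) σ -
              sCochain ℂ R q (gaugeOfSection π l y) σ) := by abel
        _ = (σ • z₂ - z₂) - (σ • z₁ - z₁) := by rw [← e1, ← e2]
        _ = σ • z₂ - σ • z₁ - (z₂ - z₁) := by abel
  refine ⟨z - (m₁ + m₂), fun w => ?_⟩
  simp only [rqCochain]
  rw [hr w]
  have e1 := hm₁ w
  have e2 := hm₂ w
  have e3 := hz (π w)
  rw [smul_sub, smul_add]
  calc sCochain ℂ R q (gaugeOfSection π l y) (π w) + rCochain π l χ y v₀ v₁ w -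
        (sCochain ℂ R q (gaugeOfSection π l' y') (π w) + rCochain π l χ yt (g⁻¹ * v₀' * g) (g⁻¹ * v₁' * g) w)
      = (sCochain ℂ R q (gaugeOfSection π l y) (π w) - sCochain ℂ R q (gaugeOfSection π l' y') (π w) -
          sCochain ℂ R (gaugeOfSection π l yt) (gaugeOfSection π l y) (π w)) -
        (rCochain π l χ yt (g⁻¹ * v₀' * g) (g⁻¹ * v₁' * g) w - rCochain π l χ y (g⁻¹ * v₀' * g) (g⁻¹ * v₁' * g) w -
          sCochain ℂ R (gaugeOfSection π l yt) (gaugeOfSection π l y) (π w)) -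
        (rCochain π l χ y (g⁻¹ * v₀' * g) (g⁻¹ * v₁' * g) w - rCochain π l χ y v₀ v₁ w) := by abel
    _ = (π w • z - z) - (π w • m₁ - m₁) - (π w • m₂ - m₂) := by rw [e1, e2, e3]
    _ = π w • z - (π w • m₁ + π w • m₂) - (z - (m₁ + m₂)) := by abel

end DischargesED6

end Literature.NumberTheory.Automorphic.LanglandsShelstad1987.KeyLemmasII

end
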